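import Literature.MathematicalPhysics.QuantumFieldTheory.Balaban1983to89.BlockAveragingEMLLinearised
import Literature.MathematicalPhysics.QuantumFieldTheory.Balaban1983to89.BlockAveragingEMLAnalyticMean

/-!
# `Balaban1983to89.BlockAveragingEMLLinearisedBackground` — [Balaban1985Averaging] PROPOSITION 3 (121)–(124) AT A SMALL-FIELD BACKGROUND `U₀`
# FOR THE SYMMETRIC BLOCK AVERAGING (0.4) OF [Balaban1987RG1] WITH THE PRINTED `exp[mean log]` ON `SU(N)`: the averaged configuration of
# `U = (1 + Y)·U₀` to FIRST ORDER in the perturbation `Y`, with an explicit remainder `O((ℓ|Y|)² + α·ℓ|Y|)` — PROVED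

T. Bałaban, *Averaging operations for lattice gauge theories*, Commun. Math. Phys. **98** (1985) 17–51 [Balaban1985Averaging], Proposition 3 p. 36
[PDF 20], verbatim: *«Let us define Q(V₀, A, c) = (1/i) log(V̿₁)_c, (121) then Q(V₀, A, c) is an analytic function of A and from (120) it follows that
its Taylor expansion begins with a first-order polynomial. Let us denote it by L(Q(V₀)A)_c, thus Q(V₀, A, c) = L(Q(V₀)A)_c + C(V₀, A, c). (122) …
|C(V₀, A, c)| ≦ C₁L²|A|² < C₁(Lα₁)². (123)»*, *«The linear form Q(V₀)A is given by (124) … The first term on the right-hand side above is the main term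
in this linear form … The remaining terms are small … can be estimated by O(L²α₀) and the terms can be estimated by O(1)L²α₀L|A|»* and (58) p. 27
*«(R_{0,y}V′)(Γ_{y,x}) = ∏_{b⊂Γ_{y,x}} R(V₀(Γ_{y,b₋}))V′_b»*, (56) *«R(X)Y = XYX⁻¹»*.  T. Bałaban, *Renormalization group approach to lattice gauge field
theories. I*, Commun. Math. Phys. **109** (1987) 249–301 [Balaban1987RG1], (0.3)–(0.4) pp. 252–253, and p. 253: *«The considerations and results of
this, and previous papers, do not depend on any particular averaging operation used; they are valid universally for all averages satisfying the above
properties.»*  T. Bałaban, *The variational problem and background fields in renormalization group method for lattice gauge theories*, Commun. Math.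
Phys. **102** (1985) 277–309 [Balaban1985Variational], (15) p. 280: *«U = U′U₀, U′ = UU₀⁻¹»* (the left perturbation of the background).

Fleet seat `ym-ust-19200-p2` (gen 2; `--supports stmt-QuantumFields-19200`, route `UnitScaleTilt`, crux K1 child «MinimiserStabilityRegPr», leaf V3
`stub_prop7From14` = [Balaban1985Variational] Prop 7 from a background (14); sub-lemma V3-D1c of the p1 lineage's split card — «identify the
linearised constraint `d(descendTo)_{U₀}`»; owner ruling 2026-08-27T01:27Z: the COVARIANT one-step version at a background `U₀ ∈ 𝔘(a)`, with the
block-axial (`R₀`) reading carried explicitly).  Sequel of `BlockAveragingEMLLinearised` (the flat background `U₀ = 1`).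

THE STATEMENT (§4, `norm_avgFun_ratio_sub_one_sub_covLinAvg_le`).  Background `U₀`, perturbed configuration `U`, perturbation `Y_b = U_b U₀,b⁻¹ − 1`
(`pertVar`, print's `U′ − 1`); `ℓ = (d+2)L`.  If `‖Y_b‖ ≤ δ` for every bond with `48ℓδ ≤ 1`, every (0.4) loop variable of the BACKGROUND at the coarse
bond `c` is within `α ≤ 1/24` of `1`, and `2ℓδ + α < δ_N`, then

  `‖Ū(c)·Ū₀(c)⁻¹ − 1 − (Q₁(U₀)Y)(c)‖ ≤ 400·ℓδ·(ℓδ + α)`,   `(Q₁(U₀)Y)(c) = |I|⁻¹ Σ_i Y_{U₀}(loop_i) + Y_{U₀}([y, y′])`   (`covLinAvg`)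

where `Y_{U₀}(Γ) = covWalkSum U₀ Y Γ` is the COVARIANT signed sum along `Γ`: each bond variable is transported back to the start of the walk by the
background holonomy of the preceding steps, `Y_{U₀}(s·Γ) = Z_s + R(g_s)Y_{U₀}(Γ)` with `g_s = U₀(s)^{±1}` the background step factor and `Z_s = Y_b` on a
forward step, `−R(U₀,b⁻¹)Y_b` on a backward one — print's `R(V₀(Γ_{y,b₋}))` of (58).  So the first-order term is linear in `Y` with coefficients
depending on `U₀` only, and the remainder is second order in `Y` PLUS `α·|Y|` — the «remaining terms … O(L²α₀)L|A|» of (124), which this file does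
not separate from the remainder (the assembly consumes main term + small).  At `U₀ = 1` this is `BlockAveragingEMLLinearised` (`covWalkSum_one`).

THE `R₀` READING (for the route's coercivity files, which work on the slice `A^{U₀}Y = 0`).  By `covWalkSum_append` the loop term splits along
`loop = Γ^σ_{y→x} ∪ [x,x′] ∪ (−Γ^{σ′}_{y′→x′}) ∪ (−c)`: the straight part carries `Y_b`, `b ⊂ [x,x′]`, transported by `R(U₀(Γ^σ_{y→x} ∪ [x, b₋]))` —
the covariant straight-line block average of the COMB-TRANSPORTED perturbation `(R_{0,c₋}Y)([x,x′])` of (125) (the route's `A^{U₀}`, up to the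
comb convention) —, the two staircase parts are the covariant comb sums whose block means are the linearised coarse gauge transformation
`v(y)` of [B7] (62)–(63) (flat case: `BlockAveragingEMLLinearised.linAvg_eq_bondAvg_sub_grad_combMean`), and the `(−c)` part cancels against
`Y_{U₀}([y,y′])` up to conjugation by background loop variables (`O(α|Y|)`, inside the remainder).  The algebraic split is `covWalkSum_append` +
`covWalkSum_one`; the named four-term decomposition is left to the consumer's conventions.

THE MECHANISM.  Step factors of `U` are `(1 + Z_s)·g_s` with `Z_s = Y_b` (forward) and `Z_s = R(U₀,b⁻¹)(Y_b^*)` EXACTLY (backward, unitarity),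
`Y_b^* = −Y_b + O(|Y_b|²)`; hence `U(Γ)U₀(Γ)⁻¹ − 1 = Y_{U₀}(Γ) + O((1+δ)^{|Γ|} − 1 − |Γ|δ + |Γ|δ²)` by the recursion `D′ = Z + R(g)D + Z·R(g)D` (§3);
the correction factor is `exp[mean log]`, an analytic mean (`BlockAveragingEMLAnalyticMean.isAnalyticMean_eml`): at the background family `W⁰`
(within `α` of `1`) its increment is the mean of the increments up to `48‖V‖² + 144‖V‖α` (`IsAnalyticMean.norm_sub_sub_fderiv_le`,
`norm_fderiv_eml_sub_mean_le`); and `Ū = κ·U(c)`, `Ū₀ = κ₀·U₀(c)` are recombined with `‖κ₀ − 1‖ ≤ 2α` (`BlockAveragingEMLProp2.dist1_corr_le_two_mul`).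

WHAT IS PROVED (kernel; defs `pertVar`, `covStep`, `covWalkSum`, `covLinAvg`; 0 `sorry`; cited inputs BY NAME).
* §2 the covariant signed sum: `covWalkSum_nil/cons/append`, `covWalkSum_one` (flat background: `= walkSum`), `norm_covWalkSum_le` (`≤ |Γ|·δ`).
* §3 **`norm_holRatio_bounds`** (`‖U(Γ)U₀(Γ)⁻¹ − 1‖ ≤ (1+δ)^m − 1` and `‖U(Γ)U₀(Γ)⁻¹ − 1 − Y_{U₀}(Γ)‖ ≤ (1+δ)^m − 1 − mδ + mδ²`), `stepFactor_mul_star_stepFactor`, and the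
  `≤ m`-step forms `norm_holRatio_bounds_of_length_le` (`2mδ`, `3m²δ²`).
* §4 `norm_eml_add_sub_sub_mean_le` (analytic-mean increment at a near-identity tuple), `covLinAvg`, **`norm_avgFun_ratio_sub_one_sub_covLinAvg_le`**.

* §5 (v1.1) **THE `R₀` FORM**: `covWalkSum_walk_wordRev` (`Y_{U₀}(−Γ) = −R(U₀(Γ)⁻¹)Y_{U₀}(Γ)`), `covWalkSum_loop_eq` (the loop term split along its four
  segments), `covLinAvgR0` (comb sum + comb-transported straight line − loop-transported comb sum), `covLinAvg_sub_covLinAvgR0`, and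
  **`norm_avgFun_ratio_sub_one_sub_covLinAvgR0_le`** (`≤ 404·ℓδ·(ℓδ + α)`).

* §6 (v1.2) `covWalkSum_add/_smul`, `covLinAvgR0_add/_smul` (the linear term IS linear), `norm_covLinAvgR0_le` ((126) crude: `‖Q₁^{R₀}(U₀)Y‖ ≤ 3ℓ·max|Y|`).

HONEST FRAMING.  A kernel proof of one printed proposition of [B7] at a general small-field background for the averaging the programmes use
([I] (0.4)), in the form «main term + small»; the `k`-fold Prop. 4, the right inverse (125)∕[7] Sect. C, and the separation of the `O(L²α₀)|A|`
terms into the linear operator are NOT here.  Nothing else of Bałaban's is asserted; no summit statement is proved; one finite torus, fixed level.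
-/

noncomputable section

open scoped BigOperators

namespace Literature.MathematicalPhysics.QuantumFieldTheory.Balaban1983to89.BlockAveragingEMLLinearisedBackground

open BlockAveragingEMLLinearised

/-! ## §1 Private letters -/

section Algebra

variable {𝔸 : Type*} [NormedRing 𝔸]

/-- `(1+b)^m − 1 ≤ m·b·(1+b)^m` (`b ≥ 0`). [folklore] -/
private theorem one_add_pow_sub_one_le (b : ℝ) (hb : 0 ≤ b) : ∀ m : ℕ, (1 + b) ^ m - 1 ≤ m * b * (1 + b) ^ m
  | 0 => by simp
  | m + 1 => by
    have ih := one_add_pow_sub_one_le b hb m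
    have hm : (0 : ℝ) ≤ m := Nat.cast_nonneg m
    have hp : (0 : ℝ) ≤ (1 + b) ^ m := pow_nonneg (by linarith) m
    push_cast
    rw [pow_succ]
    nlinarith [mul_nonneg (mul_nonneg hm hb) hp, mul_nonneg hb hp]

/-- `(1+b)^m − 1 − m·b ≤ m²·b²·(1+b)^m` (`b ≥ 0`). [folklore] -/
private theorem one_add_pow_sub_one_sub_mul_le (b : ℝ) (hb : 0 ≤ b) :
    ∀ m : ℕ, (1 + b) ^ m - 1 - m * b ≤ (m : ℝ) ^ 2 * b ^ 2 * (1 + b) ^ m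
  | 0 => by simp
  | m + 1 => by
    have ih := one_add_pow_sub_one_sub_mul_le b hb m
    have ih₁ := one_add_pow_sub_one_le b hb m
    have hm : (0 : ℝ) ≤ m := Nat.cast_nonneg m
    have hp : (1 : ℝ) ≤ (1 + b) ^ m := one_le_pow₀ (by linarith)
    push_cast
    rw [pow_succ]
    nlinarith [mul_nonneg (mul_nonneg hm hb) (mul_nonneg hb (sub_nonneg.2 hp)), mul_nonneg hm (mul_nonneg hb hb),
      mul_nonneg (mul_nonneg hb hb) (sub_nonneg.2 hp)]

/-- `(1+b)^m ≤ 2` when `m·b ≤ ½` (`b ≥ 0`). [folklore] -/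
private theorem one_add_pow_le_two {b : ℝ} (hb : 0 ≤ b) {m : ℕ} (hmb : (m : ℝ) * b ≤ 1 / 2) : (1 + b) ^ m ≤ 2 := by
  have h1 : (1 + b) ^ m ≤ Real.exp b ^ m :=
    pow_le_pow_left₀ (by linarith) (by linarith [Real.add_one_le_exp b]) m
  have h2 : Real.exp b ^ m = Real.exp ((m : ℝ) * b) := by rw [← Real.exp_nat_mul]
  have h3 : Real.exp ((m : ℝ) * b) ≤ Real.exp (1 / 2) := Real.exp_le_exp.2 hmb
  have h4 : Real.exp (1 / 2) ≤ 2 := by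
    have he : Real.exp (1 / 2) ^ 2 = Real.exp 1 := by rw [← Real.exp_nat_mul]; norm_num
    have h9 := Real.exp_one_lt_d9
    nlinarith [Real.exp_pos (1 / 2 : ℝ)]
  linarith

/-- `(1+b)^m − 1 ≤ 2mb` and `(1+b)^m − 1 − mb + mb² ≤ 3m²b²` for `mb ≤ ½`. [folklore] -/
private theorem envelopes {b : ℝ} (hb : 0 ≤ b) {m : ℕ} (hmb : (m : ℝ) * b ≤ 1 / 2) :
    (1 + b) ^ m - 1 ≤ 2 * m * b ∧ (1 + b) ^ m - 1 - m * b + m * b ^ 2 ≤ 3 * (m : ℝ) ^ 2 * b ^ 2 := by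
  have h2 := one_add_pow_le_two hb hmb
  have h1 := one_add_pow_sub_one_le b hb m
  have h3 := one_add_pow_sub_one_sub_mul_le b hb m
  have hm : (0 : ℝ) ≤ m := Nat.cast_nonneg m
  have hmm : (m : ℝ) ≤ (m : ℝ) ^ 2 := by
    rcases Nat.eq_zero_or_pos m with h | h
    · simp [h]
    · have : (1 : ℝ) ≤ m := by exact_mod_cast h
      nlinarith
  constructor
  · nlinarith [mul_nonneg (mul_nonneg hm hb) (by linarith : (0 : ℝ) ≤ 2 - (1 + b) ^ m)]
  · nlinarith [mul_nonneg (mul_nonneg (sq_nonneg (m : ℝ)) (sq_nonneg b)) (by linarith : (0 : ℝ) ≤ 2 - (1 + b) ^ m),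
      mul_le_mul_of_nonneg_right hmm (sq_nonneg b)]

variable [NormedAlgebra ℂ 𝔸]

/-- The mean of a family bounded by `B` in norm has norm `≤ B`. [folklore] -/
private theorem norm_mean_le {ι : Type*} [Fintype ι] [Nonempty ι] {m : ι → 𝔸} {B : ℝ} (h : ∀ i, ‖m i‖ ≤ B) :
    ‖((Fintype.card ι : ℂ))⁻¹ • ∑ i, m i‖ ≤ B := by
  have hc : (0 : ℝ) < Fintype.card ι := Nat.cast_pos.mpr Fintype.card_pos
  have hsum : ∑ i, ‖m i‖ ≤ ∑ _i : ι, B := Finset.sum_le_sum fun i _ => h i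
  rw [Finset.sum_const, Finset.card_univ, nsmul_eq_mul] at hsum
  rw [norm_smul, norm_inv, Complex.norm_natCast, inv_mul_le_iff₀ hc]
  exact (norm_sum_le _ _).trans hsum

end Algebra

/-! ## §2 The perturbation variable and the covariant signed sum -/

section Cov

open T4Continuum BlockAveraging
open scoped Matrix.Norms.L2Operator

variable {n : Type*} [Fintype n] [DecidableEq n] {P : Params} {j : ℕ}

/-- Elements of `SU(N)` are unitary matrices. [folklore] -/
private theorem coe_mem_unitaryGroup (g : Matrix.specialUnitaryGroup n ℂ) : (g : Matrix n n ℂ) ∈ Matrix.unitaryGroup n ℂ :=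
  (Matrix.mem_specialUnitaryGroup_iff.1 g.2).1

/-- `g* · g = 1` for `g ∈ SU(N)`. [folklore] -/
private theorem coe_star_mul_self (g : Matrix.specialUnitaryGroup n ℂ) : star (g : Matrix n n ℂ) * (g : Matrix n n ℂ) = 1 :=
  Unitary.star_mul_self_of_mem (coe_mem_unitaryGroup g)

/-- `g · g* = 1` for `g ∈ SU(N)`. [folklore] -/
private theorem coe_mul_star_self (g : Matrix.specialUnitaryGroup n ℂ) : (g : Matrix n n ℂ) * star (g : Matrix n n ℂ) = 1 :=
  Unitary.mul_star_self_of_mem (coe_mem_unitaryGroup g)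

/-- The inverse in `SU(N)` is the conjugate transpose (coercion lemma). [folklore] -/
private theorem coe_inv_eq_star (g : Matrix.specialUnitaryGroup n ℂ) :
    ((g⁻¹ : Matrix.specialUnitaryGroup n ℂ) : Matrix n n ℂ) = star (g : Matrix n n ℂ) := rfl

variable [Nonempty n]

/-- `‖g‖ = 1` (operator norm) for `g ∈ SU(N)`. [folklore] -/
private theorem norm_coe_eq_one (g : Matrix.specialUnitaryGroup n ℂ) : ‖(g : Matrix n n ℂ)‖ = 1 :=
  CStarRing.norm_of_mem_unitary (coe_mem_unitaryGroup g)

/-- `‖g*‖ = 1` for `g ∈ SU(N)`. [folklore] -/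
private theorem norm_star_coe_eq_one (g : Matrix.specialUnitaryGroup n ℂ) : ‖star (g : Matrix n n ℂ)‖ = 1 := by
  rw [← coe_inv_eq_star, norm_coe_eq_one]

omit [Nonempty n] in
/-- The background step factor is unitary: `g_s · g_s* = 1`. [folklore] -/
private theorem stepFactor_mul_star (U₀ : GaugeField P j (Matrix.specialUnitaryGroup n ℂ)) (s : LStep P j) :
    stepFactor U₀ s * star (stepFactor U₀ s) = 1 := by
  unfold stepFactor
  cases s.fwd
  · simp only [Bool.false_eq_true, ↓reduceIte, star_star]; exact coe_star_mul_self _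
  · simp only [↓reduceIte]; exact coe_mul_star_self _

omit [Nonempty n] in
/-- The background step factor is unitary: `g_s* · g_s = 1`. [folklore] -/
private theorem star_mul_stepFactor (U₀ : GaugeField P j (Matrix.specialUnitaryGroup n ℂ)) (s : LStep P j) :
    star (stepFactor U₀ s) * stepFactor U₀ s = 1 := by
  unfold stepFactor
  cases s.fwd
  · simp only [Bool.false_eq_true, ↓reduceIte, star_star]; exact coe_mul_star_self _
  · simp only [↓reduceIte]; exact coe_star_mul_self _

/-- `‖g_s‖ = 1`. [folklore] -/
private theorem norm_stepFactor (U₀ : GaugeField P j (Matrix.specialUnitaryGroup n ℂ)) (s : LStep P j) : ‖stepFactor U₀ s‖ = 1 := by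
  unfold stepFactor
  cases s.fwd
  · simp only [Bool.false_eq_true, ↓reduceIte]; exact norm_star_coe_eq_one _
  · simp only [↓reduceIte]; exact norm_coe_eq_one _

/-- `‖g_s*‖ = 1`. [folklore] -/
private theorem norm_star_stepFactor (U₀ : GaugeField P j (Matrix.specialUnitaryGroup n ℂ)) (s : LStep P j) :
    ‖star (stepFactor U₀ s)‖ = 1 := by
  unfold stepFactor
  cases s.fwd
  · simp only [Bool.false_eq_true, ↓reduceIte, star_star]; exact norm_coe_eq_one _
  · simp only [↓reduceIte]; exact norm_star_coe_eq_one _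

/-- Unitary conjugation does not increase the norm: `‖g X g*‖ ≤ ‖X‖`. [folklore] -/
private theorem norm_conj_stepFactor_le (U₀ : GaugeField P j (Matrix.specialUnitaryGroup n ℂ)) (s : LStep P j) (X : Matrix n n ℂ) :
    ‖stepFactor U₀ s * X * star (stepFactor U₀ s)‖ ≤ ‖X‖ := by
  calc _ ≤ ‖stepFactor U₀ s‖ * ‖X‖ * ‖star (stepFactor U₀ s)‖ := (norm_mul_le _ _).trans (mul_le_mul_of_nonneg_right (norm_mul_le _ _) (norm_nonneg _))
    _ = ‖X‖ := by rw [norm_stepFactor, norm_star_stepFactor, one_mul, mul_one]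

/-- **THE PERTURBATION VARIABLE `Y_b = U_b·U₀,b⁻¹ − 1`** (print's `U′ − 1`, `U = U′U₀` (15)), read in `M_N(ℂ)`. [cite: Balaban1985Variational, (15) p.280] -/
def pertVar (U₀ U : GaugeField P j (Matrix.specialUnitaryGroup n ℂ)) (b : PBond P j) : Matrix n n ℂ :=
  ((U b * (U₀ b)⁻¹ : Matrix.specialUnitaryGroup n ℂ) : Matrix n n ℂ) - 1

omit [Nonempty n] in
/-- `pertVar` unfolded: `Y_b = U_b·U₀,b* − 1`. [cite: Balaban1985Variational, (15) p.280] -/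
theorem pertVar_eq (U₀ U : GaugeField P j (Matrix.specialUnitaryGroup n ℂ)) (b : PBond P j) :
    pertVar U₀ U b = ((U b : Matrix.specialUnitaryGroup n ℂ) : Matrix n n ℂ) * star ((U₀ b : Matrix.specialUnitaryGroup n ℂ) : Matrix n n ℂ) - 1 := by
  rw [pertVar, Submonoid.coe_mul, coe_inv_eq_star]

/-- **THE COVARIANT STEP TERM**: `Z_s = Y_b` on a forward step, `−R(U₀,b⁻¹)Y_b = −U₀,b* Y_b U₀,b` on a backward one (the first-order part of the
step factor of `U` relative to that of `U₀`, transported to the start of the step). [cite: Balaban1985Averaging, (56)-(58) p.27] -/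
def covStep (U₀ : GaugeField P j (Matrix.specialUnitaryGroup n ℂ)) (Y : PBond P j → Matrix n n ℂ) (s : LStep P j) : Matrix n n ℂ :=
  if s.fwd then Y s.bond else -(stepFactor U₀ s * Y s.bond * star (stepFactor U₀ s))

/-- **THE COVARIANT SIGNED SUM `Y_{U₀}(Γ)`** of a bond field along a sequence of steps: each step term is transported back to the start of the walk
by the background holonomy of the preceding steps, `Y_{U₀}(s·Γ) = Z_s + R(g_s)·Y_{U₀}(Γ)` — print's `∏ R(V₀(Γ_{y,b₋}))V′_b` read to first order.
[cite: Balaban1985Averaging, (58) p.27] -/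
def covWalkSum (U₀ : GaugeField P j (Matrix.specialUnitaryGroup n ℂ)) (Y : PBond P j → Matrix n n ℂ) : List (LStep P j) → Matrix n n ℂ
  | [] => 0
  | s :: γ => covStep U₀ Y s + stepFactor U₀ s * covWalkSum U₀ Y γ * star (stepFactor U₀ s)

omit [Nonempty n] in
/-- No steps, zero sum. [cite: Balaban1985Averaging, (58) p.27 (bookkeeping)] -/
@[simp] theorem covWalkSum_nil (U₀ : GaugeField P j (Matrix.specialUnitaryGroup n ℂ)) (Y : PBond P j → Matrix n n ℂ) :
    covWalkSum U₀ Y [] = 0 := rfl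

omit [Nonempty n] in
/-- One step more: `Y_{U₀}(s·Γ) = Z_s + g_s·Y_{U₀}(Γ)·g_s*`. [cite: Balaban1985Averaging, (58) p.27 (bookkeeping)] -/
theorem covWalkSum_cons (U₀ : GaugeField P j (Matrix.specialUnitaryGroup n ℂ)) (Y : PBond P j → Matrix n n ℂ) (s : LStep P j)
    (γ : List (LStep P j)) :
    covWalkSum U₀ Y (s :: γ) = covStep U₀ Y s + stepFactor U₀ s * covWalkSum U₀ Y γ * star (stepFactor U₀ s) := rfl

/-- **CONCATENATION**: `Y_{U₀}(Γ₁ ∪ Γ₂) = Y_{U₀}(Γ₁) + R(U₀(Γ₁))·Y_{U₀}(Γ₂)` — the second walk's terms are transported by the background holonomy of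
the first. [cite: Balaban1985Averaging, (58) p.27] -/
theorem covWalkSum_append (U₀ : GaugeField P j (Matrix.specialUnitaryGroup n ℂ)) (Y : PBond P j → Matrix n n ℂ) :
    ∀ γ₁ γ₂ : List (LStep P j), covWalkSum U₀ Y (γ₁ ++ γ₂) =
      covWalkSum U₀ Y γ₁ + ((holAt U₀ γ₁ : Matrix.specialUnitaryGroup n ℂ) : Matrix n n ℂ) * covWalkSum U₀ Y γ₂ *
        star ((holAt U₀ γ₁ : Matrix.specialUnitaryGroup n ℂ) : Matrix n n ℂ)
  | [], γ₂ => by simp [holAt_nil]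
  | s :: γ₁, γ₂ => by
    rw [List.cons_append, covWalkSum_cons, covWalkSum_cons, covWalkSum_append U₀ Y γ₁ γ₂, coe_holAt_eq_prod_stepFactor U₀ (s :: γ₁),
      List.map_cons, List.prod_cons, ← coe_holAt_eq_prod_stepFactor U₀ γ₁, star_mul]
    noncomm_ring

/-- **FLAT BACKGROUND**: at `U₀ = 1` the covariant signed sum is the plain signed sum `walkSum` of `BlockAveragingEMLLinearised`. [cite: Balaban1985Averaging, (58) p.27] -/
theorem covWalkSum_one (Y : PBond P j → Matrix n n ℂ) :
    ∀ γ : List (LStep P j), covWalkSum (1 : GaugeField P j (Matrix.specialUnitaryGroup n ℂ)) Y γ = walkSum Y γ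
  | [] => by simp
  | s :: γ => by
    have h1 : stepFactor (1 : GaugeField P j (Matrix.specialUnitaryGroup n ℂ)) s = 1 := by
      have hb : (1 : GaugeField P j (Matrix.specialUnitaryGroup n ℂ)) s.bond = 1 := rfl
      unfold stepFactor
      rw [hb]
      cases s.fwd <;> simp
    rw [covWalkSum_cons, walkSum_cons, covWalkSum_one Y γ, covStep, h1]
    simp

/-- `‖Z_s‖ ≤ ‖Y_b‖`. [cite: Balaban1985Averaging, (56)-(58) p.27 (bookkeeping)] -/
theorem norm_covStep_le (U₀ : GaugeField P j (Matrix.specialUnitaryGroup n ℂ)) (Y : PBond P j → Matrix n n ℂ) (s : LStep P j) :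
    ‖covStep U₀ Y s‖ ≤ ‖Y s.bond‖ := by
  unfold covStep
  cases s.fwd
  · simp only [Bool.false_eq_true, ↓reduceIte, norm_neg]; exact norm_conj_stepFactor_le U₀ s _
  · simp

/-- `‖Y_{U₀}(Γ)‖ ≤ |Γ|·δ` when every `‖Y_b‖ ≤ δ`. [cite: Balaban1985Averaging, (58) p.27 (bookkeeping)] -/
theorem norm_covWalkSum_le (U₀ : GaugeField P j (Matrix.specialUnitaryGroup n ℂ)) {Y : PBond P j → Matrix n n ℂ} {δ : ℝ}
    (hY : ∀ b, ‖Y b‖ ≤ δ) : ∀ γ : List (LStep P j), ‖covWalkSum U₀ Y γ‖ ≤ γ.length * δ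
  | [] => by simp
  | s :: γ => by
    rw [covWalkSum_cons, List.length_cons]
    calc _ ≤ ‖covStep U₀ Y s‖ + ‖stepFactor U₀ s * covWalkSum U₀ Y γ * star (stepFactor U₀ s)‖ := norm_add_le _ _
      _ ≤ δ + γ.length * δ := add_le_add ((norm_covStep_le U₀ Y s).trans (hY _)) ((norm_conj_stepFactor_le U₀ s _).trans (norm_covWalkSum_le U₀ hY γ))
      _ = ((γ.length + 1 : ℕ) : ℝ) * δ := by push_cast; ring

end Cov

/-! ## §3 The holonomy of `U = (1+Y)U₀` relative to that of `U₀`, to first order in `Y` -/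

section Hol

open T4Continuum BlockAveraging
open scoped Matrix.Norms.L2Operator

variable {n : Type*} [Fintype n] [DecidableEq n] [Nonempty n] {P : Params} {j : ℕ}

omit [Nonempty n] in
/-- The step factor of `U` relative to that of `U₀`: `f_s·g_s* = 1 + Y_b` (forward), `= g_s·(1 + Y_b)*·g_s*` EXACTLY (backward, `g_s = U₀,b*`).
[cite: Balaban1985Averaging, (56)-(58) p.27 (bookkeeping)] -/
theorem stepFactor_mul_star_stepFactor (U₀ U : GaugeField P j (Matrix.specialUnitaryGroup n ℂ)) (s : LStep P j) :
    stepFactor U s * star (stepFactor U₀ s) =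
      if s.fwd then 1 + pertVar U₀ U s.bond
      else stepFactor U₀ s * star (1 + pertVar U₀ U s.bond) * star (stepFactor U₀ s) := by
  unfold stepFactor
  rw [pertVar_eq]
  cases s.fwd
  · simp only [Bool.false_eq_true, ↓reduceIte, star_star, star_mul, add_sub_cancel]
    -- `U_b* U₀,b = U₀,b* (U₀,b U_b*) U₀,b`
    rw [← mul_assoc (star _), coe_star_mul_self, one_mul]
  · simp only [↓reduceIte, add_sub_cancel]

/-- **THE RELATIVE HOLONOMY TO FIRST ORDER**: with `Y = pertVar U₀ U`, `‖Y_b‖ ≤ δ` for every bond, and `D(Γ) = U(Γ)·U₀(Γ)* − 1`: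
`‖D(Γ)‖ ≤ (1+δ)^m − 1` and `‖D(Γ) − Y_{U₀}(Γ)‖ ≤ (1+δ)^m − 1 − mδ + mδ²` (`m = |Γ|`) — the recursion `D(s·Γ) = Z_s + R(g_s)D(Γ) + Z_s·R(g_s)D(Γ)`
with `Z_s` the exact relative step term (`‖Z_s‖ ≤ δ`, `‖Z_s − covStep‖ ≤ δ²` by `Y_b* = −Y_b + O(|Y_b|²)`). [cite: Balaban1985Averaging, (122)-(123) p.36] -/
theorem norm_holRatio_bounds (U₀ U : GaugeField P j (Matrix.specialUnitaryGroup n ℂ)) {δ : ℝ} (hδ : 0 ≤ δ)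
    (hY : ∀ b, ‖pertVar U₀ U b‖ ≤ δ) :
    ∀ γ : List (LStep P j),
      ‖((holAt U γ : Matrix.specialUnitaryGroup n ℂ) : Matrix n n ℂ) * star ((holAt U₀ γ : Matrix.specialUnitaryGroup n ℂ) : Matrix n n ℂ) - 1‖ ≤
          (1 + δ) ^ γ.length - 1 ∧
      ‖((holAt U γ : Matrix.specialUnitaryGroup n ℂ) : Matrix n n ℂ) * star ((holAt U₀ γ : Matrix.specialUnitaryGroup n ℂ) : Matrix n n ℂ) - 1 -
          covWalkSum U₀ (pertVar U₀ U) γ‖ ≤ (1 + δ) ^ γ.length - 1 - γ.length * δ + γ.length * δ ^ 2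
  | [] => by simp [holAt_nil]
  | s :: γ => by
    obtain ⟨ih₀, ih₁⟩ := norm_holRatio_bounds U₀ U hδ hY γ
    -- letters
    set F : Matrix n n ℂ := ((holAt U γ : Matrix.specialUnitaryGroup n ℂ) : Matrix n n ℂ) with hF
    set F₀ : Matrix n n ℂ := ((holAt U₀ γ : Matrix.specialUnitaryGroup n ℂ) : Matrix n n ℂ) with hF₀
    set f : Matrix n n ℂ := stepFactor U s with hf
    set g : Matrix n n ℂ := stepFactor U₀ s with hg
    set D : Matrix n n ℂ := F * star F₀ - 1 with hD
    set Λ : Matrix n n ℂ := covWalkSum U₀ (pertVar U₀ U) γ with hΛ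
    set Y : PBond P j → Matrix n n ℂ := pertVar U₀ U with hYdef
    -- the exact relative step term `Z = f g* − 1`
    set Z : Matrix n n ℂ := f * star g - 1 with hZ
    have hgg : g * star g = 1 := stepFactor_mul_star U₀ s
    -- `Z` to zeroth and first order
    have hZ0 : ‖Z‖ ≤ δ ∧ ‖Z - covStep U₀ Y s‖ ≤ δ ^ 2 := by
      have hfg := stepFactor_mul_star_stepFactor U₀ U s
      rw [← hf, ← hg, ← hYdef] at hfg
      unfold covStep
      revert hfg
      cases s.fwd <;> intro hfg
      · -- backward: `Z = g (1+Y)* g* − 1 = g ((1+Y)* − 1) g*`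
        simp only [Bool.false_eq_true, ↓reduceIte] at hfg ⊢
        have eZ : Z = g * (star (1 + Y s.bond) - 1) * star g := by
          rw [hZ, hfg, mul_sub, sub_mul, mul_one, hgg]
        have hstar : star (1 + Y s.bond) - 1 = star (((U s.bond * (U₀ s.bond)⁻¹ : Matrix.specialUnitaryGroup n ℂ) : Matrix n n ℂ)) - 1 := by
          rw [hYdef, pertVar, add_sub_cancel]
        constructor
        · rw [eZ]
          refine (norm_conj_stepFactor_le U₀ s _).trans ?_
          rw [hstar, ← coe_inv_eq_star, ← FederbushMean.dist1_SU_eq, GaugeGroup.dist1_inv, FederbushMean.dist1_SU_eq]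
          exact hY s.bond
        · have e2 : Z - -(g * Y s.bond * star g) = g * (star (1 + Y s.bond) - 1 + Y s.bond) * star g := by rw [eZ]; noncomm_ring
          rw [e2]
          refine (norm_conj_stepFactor_le U₀ s _).trans ?_
          have h3 : star (1 + Y s.bond) - 1 + Y s.bond =
              star (((U s.bond * (U₀ s.bond)⁻¹ : Matrix.specialUnitaryGroup n ℂ) : Matrix n n ℂ)) - 1 +
                ((((U s.bond * (U₀ s.bond)⁻¹ : Matrix.specialUnitaryGroup n ℂ) : Matrix n n ℂ)) - 1) := by
            rw [hYdef, pertVar, add_sub_cancel]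
          rw [h3]
          refine (norm_star_sub_one_add_le' _).trans ?_
          exact pow_le_pow_left₀ (norm_nonneg _) (hY s.bond) 2
      · -- forward: `Z = Y`
        simp only [↓reduceIte] at hfg ⊢
        have eZ : Z = Y s.bond := by rw [hZ, hfg, add_sub_cancel_left]
        rw [eZ, sub_self, norm_zero]
        exact ⟨hY s.bond, by positivity⟩
    obtain ⟨hZδ, hZ1⟩ := hZ0
    -- the recursion `D' = Z + g D g* + Z g D g*`
    have hF' : ((holAt U (s :: γ) : Matrix.specialUnitaryGroup n ℂ) : Matrix n n ℂ) = f * F := by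
      rw [coe_holAt_eq_prod_stepFactor, List.map_cons, List.prod_cons, ← coe_holAt_eq_prod_stepFactor]
    have hF₀' : ((holAt U₀ (s :: γ) : Matrix.specialUnitaryGroup n ℂ) : Matrix n n ℂ) = g * F₀ := by
      rw [coe_holAt_eq_prod_stepFactor, List.map_cons, List.prod_cons, ← coe_holAt_eq_prod_stepFactor]
    have hgg' : star g * g = 1 := star_mul_stepFactor U₀ s
    have erec : f * F * star (g * F₀) - 1 = Z + g * D * star g + Z * (g * D * star g) := by
      rw [star_mul, hZ, hD]
      have e1 : (f * star g - 1) * (g * (F * star F₀ - 1) * star g) =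
          f * (star g * g) * (F * star F₀ - 1) * star g - g * (F * star F₀ - 1) * star g := by noncomm_ring
      rw [e1, hgg', mul_one]
      noncomm_ring
    rw [hF', hF₀', List.length_cons, covWalkSum_cons, erec]
    have hconj : ‖g * D * star g‖ ≤ ‖D‖ := norm_conj_stepFactor_le U₀ s D
    have hp : (1 : ℝ) ≤ (1 + δ) ^ γ.length := one_le_pow₀ (by linarith)
    constructor
    · calc ‖Z + g * D * star g + Z * (g * D * star g)‖ ≤ ‖Z‖ + ‖g * D * star g‖ + ‖Z‖ * ‖g * D * star g‖ :=
            (norm_add_le _ _).trans (add_le_add (norm_add_le _ _) (norm_mul_le _ _))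
        _ ≤ δ + ((1 + δ) ^ γ.length - 1) + δ * ((1 + δ) ^ γ.length - 1) := by
            gcongr
            · exact hconj.trans ih₀
            · exact hconj.trans ih₀
        _ = (1 + δ) ^ (γ.length + 1) - 1 := by ring
    · have e : Z + g * D * star g + Z * (g * D * star g) - (covStep U₀ Y s + g * Λ * star g) =
          (Z - covStep U₀ Y s) + g * (D - Λ) * star g + Z * (g * D * star g) := by noncomm_ring
      rw [e]
      calc ‖(Z - covStep U₀ Y s) + g * (D - Λ) * star g + Z * (g * D * star g)‖
          ≤ ‖Z - covStep U₀ Y s‖ + ‖g * (D - Λ) * star g‖ + ‖Z‖ * ‖g * D * star g‖ :=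
            (norm_add_le _ _).trans (add_le_add (norm_add_le _ _) (norm_mul_le _ _))
        _ ≤ δ ^ 2 + ((1 + δ) ^ γ.length - 1 - γ.length * δ + γ.length * δ ^ 2) + δ * ((1 + δ) ^ γ.length - 1) := by
            gcongr
            · exact (norm_conj_stepFactor_le U₀ s _).trans ih₁
            · exact hconj.trans ih₀
        _ = (1 + δ) ^ (γ.length + 1) - 1 - ((γ.length + 1 : ℕ) : ℝ) * δ + ((γ.length + 1 : ℕ) : ℝ) * δ ^ 2 := by push_cast; ring
  where
  /-- `‖g* − 1 + (g − 1)‖ ≤ ‖g − 1‖²` for `g ∈ SU(N)` (`g* − 1 + (g − 1) = g*(g − 1)²`). [folklore] -/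
  norm_star_sub_one_add_le' (g : Matrix.specialUnitaryGroup n ℂ) :
      ‖star (g : Matrix n n ℂ) - 1 + ((g : Matrix n n ℂ) - 1)‖ ≤ ‖(g : Matrix n n ℂ) - 1‖ ^ 2 := by
    have e : star (g : Matrix n n ℂ) - 1 + ((g : Matrix n n ℂ) - 1) =
        star (g : Matrix n n ℂ) * (((g : Matrix n n ℂ) - 1) * ((g : Matrix n n ℂ) - 1)) := by
      have h := coe_star_mul_self g
      have e1 : star (g : Matrix n n ℂ) * (((g : Matrix n n ℂ) - 1) * ((g : Matrix n n ℂ) - 1)) =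
          star (g : Matrix n n ℂ) * (g : Matrix n n ℂ) * (g : Matrix n n ℂ) - star (g : Matrix n n ℂ) * (g : Matrix n n ℂ) -
            star (g : Matrix n n ℂ) * (g : Matrix n n ℂ) + star (g : Matrix n n ℂ) := by noncomm_ring
      rw [e1, h]; noncomm_ring
    rw [e]
    calc ‖star (g : Matrix n n ℂ) * (((g : Matrix n n ℂ) - 1) * ((g : Matrix n n ℂ) - 1))‖
        ≤ ‖star (g : Matrix n n ℂ)‖ * (‖(g : Matrix n n ℂ) - 1‖ * ‖(g : Matrix n n ℂ) - 1‖) :=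
          (norm_mul_le _ _).trans (mul_le_mul_of_nonneg_left (norm_mul_le _ _) (norm_nonneg _))
      _ = ‖(g : Matrix n n ℂ) - 1‖ ^ 2 := by rw [norm_star_coe_eq_one, one_mul, sq]

/-- `≤ m` steps with `mδ ≤ ½`: `‖U(Γ)U₀(Γ)* − 1‖ ≤ 2mδ` and `‖U(Γ)U₀(Γ)* − 1 − Y_{U₀}(Γ)‖ ≤ 3m²δ²`. [cite: Balaban1985Averaging, (122)-(123) p.36] -/
theorem norm_holRatio_bounds_of_length_le (U₀ U : GaugeField P j (Matrix.specialUnitaryGroup n ℂ)) {δ : ℝ} (hδ : 0 ≤ δ)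
    (hY : ∀ b, ‖pertVar U₀ U b‖ ≤ δ) {m : ℕ} (hm : (m : ℝ) * δ ≤ 1 / 2) (γ : List (LStep P j)) (hγ : γ.length ≤ m) :
    ‖((holAt U γ : Matrix.specialUnitaryGroup n ℂ) : Matrix n n ℂ) * star ((holAt U₀ γ : Matrix.specialUnitaryGroup n ℂ) : Matrix n n ℂ) - 1‖ ≤
        2 * m * δ ∧
      ‖((holAt U γ : Matrix.specialUnitaryGroup n ℂ) : Matrix n n ℂ) * star ((holAt U₀ γ : Matrix.specialUnitaryGroup n ℂ) : Matrix n n ℂ) - 1 -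
        covWalkSum U₀ (pertVar U₀ U) γ‖ ≤ 3 * (m : ℝ) ^ 2 * δ ^ 2 := by
  obtain ⟨h₀, h₁⟩ := norm_holRatio_bounds U₀ U hδ hY γ
  have hlen : (γ.length : ℝ) ≤ m := by exact_mod_cast hγ
  have hγδ : (γ.length : ℝ) * δ ≤ 1 / 2 := (mul_le_mul_of_nonneg_right hlen hδ).trans hm
  obtain ⟨e₀, e₁⟩ := envelopes hδ hγδ
  have hl0 : (0 : ℝ) ≤ γ.length := Nat.cast_nonneg _
  refine ⟨h₀.trans (e₀.trans (by nlinarith)), h₁.trans (e₁.trans ?_)⟩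
  have : (γ.length : ℝ) ^ 2 ≤ (m : ℝ) ^ 2 := pow_le_pow_left₀ hl0 hlen 2
  nlinarith [sq_nonneg δ]

end Hol

/-! ## §4 The correction factor at a background, and the averaged configuration to first order -/

section Main

open T4Continuum BlockAveraging AveragingRT ExpMeanLog LatticeWordStokes B7TransferAnalyticMean BlockAveragingEMLAnalyticMean
open scoped Matrix.Norms.L2Operator

/-- **THE ANALYTIC MEAN `exp[mean log]` AT A NEAR-IDENTITY TUPLE, TO FIRST ORDER IN THE INCREMENT**: for `‖U − 1‖ ≤ 1/24`, `‖V‖ ≤ 1/24`,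
`‖eml(U + V) − eml U − |I|⁻¹Σᵢ Vᵢ‖ ≤ 48‖V‖² + 144‖V‖·‖U − 1‖` (the second-order Taylor remainder of the analytic mean on its polydisc,
`IsAnalyticMean.norm_sub_sub_fderiv_le` at `(r, K) = (1/3, 1/2)`, and `D eml(U) = mean + O(‖U − 1‖)`, `norm_fderiv_eml_sub_mean_le`) — [Balaban1987RG1]
(0.8) «the average is close to the identity also, and (1/i) log M({exp iA_j}) = n⁻¹ΣA_j + (higher order terms)» away from the identity tuple.
[cite: Balaban1987RG1, (0.8) p.253] -/
theorem norm_eml_add_sub_sub_mean_le {ι : Type*} [Fintype ι] {𝔸 : Type*} [NormedRing 𝔸] [NormedAlgebra ℂ 𝔸] [CompleteSpace 𝔸]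
    {U V : ι → 𝔸} (hU : ‖U - 1‖ ≤ 1 / 24) (hV : ‖V‖ ≤ 1 / 24) :
    ‖eml (U + V) - eml U - ((Fintype.card ι : ℂ))⁻¹ • ∑ i, V i‖ ≤ 48 * ‖V‖ ^ 2 + 144 * ‖V‖ * ‖U - 1‖ := by
  have hA := isAnalyticMean_eml (ι := ι) (𝔸 := 𝔸)
  have hUball : U ∈ Metric.ball (1 : ι → 𝔸) (1 / 3) := by
    rw [Metric.mem_ball, dist_eq_norm]; linarith
  have hV4 : 4 * ‖V‖ ≤ 1 / 3 - ‖U - 1‖ := by linarith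
  have h1 := hA.norm_sub_sub_fderiv_le hUball hV4
  have h2 := norm_fderiv_eml_sub_mean_le hU V
  rw [meanCLM_apply] at h2
  have hden : (7 / 24 : ℝ) ≤ 1 / 3 - ‖U - 1‖ := by linarith
  have hpos : (0 : ℝ) < (1 / 3 - ‖U - 1‖) ^ 2 := by positivity
  have h1' : 8 * (1 / 2) * ‖V‖ ^ 2 / (1 / 3 - ‖U - 1‖) ^ 2 ≤ 48 * ‖V‖ ^ 2 := by
    rw [div_le_iff₀ hpos]
    have hsq : (7 / 24 : ℝ) ^ 2 ≤ (1 / 3 - ‖U - 1‖) ^ 2 := pow_le_pow_left₀ (by norm_num) hden 2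
    nlinarith [sq_nonneg ‖V‖, mul_le_mul_of_nonneg_left hsq (sq_nonneg ‖V‖)]
  have e : eml (U + V) - eml U - ((Fintype.card ι : ℂ))⁻¹ • ∑ i, V i =
      (eml (U + V) - eml U - fderiv ℂ eml U V) + (fderiv ℂ eml U V - ((Fintype.card ι : ℂ))⁻¹ • ∑ i, V i) := by abel
  rw [e]
  exact (norm_add_le _ _).trans (add_le_add (h1.trans h1') h2)

variable {n : Type*} [Fintype n] [DecidableEq n] [Nonempty n] {P : Params} {j : ℕ}

/-- **THE LINEARISED (0.4) AVERAGE AT THE BACKGROUND `U₀`**: `(Q₁(U₀)Y)(c) = |I|⁻¹ Σ_i Y_{U₀}(loop_i) + Y_{U₀}([y, y′])` — the mean over the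
index set of (0.4) of the covariant signed sums of `Y` along the loop words from the block centre `emb c₋`, plus the covariant signed sum along the
straight segment `c` (the two `(−c)`∕`c` contributions cancel to first order up to `O(α|Y|)`).  At `U₀ = 1` it is `BlockAveragingEMLLinearised.linAvg`
rearranged (`covWalkSum_one`, `covWalkSum_append`). [cite: Balaban1985Averaging, (124) p.36] -/
def covLinAvg (U₀ : GaugeField P j (Matrix.specialUnitaryGroup n ℂ)) (Y : PBond P j → Matrix n n ℂ) (c : PBond P (j + 1)) : Matrix n n ℂ :=
  ((Fintype.card (Idx P) : ℂ))⁻¹ • ∑ i : Idx P, covWalkSum U₀ Y (walk (emb c.src) (loopWord P.L c.dir (off i.1) i.2.1 i.2.2)) +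
    covWalkSum U₀ Y (walk (emb c.src) (List.replicate P.L (c.dir, true)))

omit [Nonempty n] in
/-- `covLinAvg` unfolded. [cite: Balaban1985Averaging, (124) p.36] -/
theorem covLinAvg_def (U₀ : GaugeField P j (Matrix.specialUnitaryGroup n ℂ)) (Y : PBond P j → Matrix n n ℂ) (c : PBond P (j + 1)) :
    covLinAvg U₀ Y c = ((Fintype.card (Idx P) : ℂ))⁻¹ • ∑ i : Idx P, covWalkSum U₀ Y (walk (emb c.src) (loopWord P.L c.dir (off i.1) i.2.1 i.2.2)) +
      covWalkSum U₀ Y (walk (emb c.src) (List.replicate P.L (c.dir, true))) := rfl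
set_option maxHeartbeats 400000 in
/-- **[Balaban1985Averaging] PROP. 3 (122)–(124) AT A SMALL-FIELD BACKGROUND FOR THE (0.4) AVERAGING OF RECORD** (`exp[mean log]` on `SU(N)`, any
torus of `Setup`, any level), in the form «main term + small»: background `U₀` whose (0.4) loop variables at `c` are within `α ≤ 1/24` of `1`,
perturbation `Y_b = U_bU₀,b⁻¹ − 1` with `‖Y_b‖ ≤ δ`, `48ℓδ ≤ 1` (`ℓ = (d+2)L`), `2ℓδ + α < δ_N` ⇒
`‖Ū(c)·Ū₀(c)* − 1 − (Q₁(U₀)Y)(c)‖ ≤ 400·ℓδ·(ℓδ + α)` (`Ū = avgFun expMeanLogSU U`, `Q₁(U₀) = covLinAvg U₀`): the averaged configuration relative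
to the averaged background is LINEAR in the perturbation up to a remainder quadratic in `ℓ|Y|` plus `α·ℓ|Y|` (print: `C₁L²|A|²` and the
`O(L²α₀)L|A|` terms of (124)). [cite: Balaban1985Averaging, Prop. 3 (122)-(124) p.36] -/
theorem norm_avgFun_ratio_sub_one_sub_covLinAvg_le (U₀ U : GaugeField P j (Matrix.specialUnitaryGroup n ℂ)) {δ α : ℝ} (hδ : 0 ≤ δ)
    (hY : ∀ b, ‖pertVar U₀ U b‖ ≤ δ) (h48 : 48 * ((((P.d + 2) * P.L : ℕ) : ℝ) * δ) ≤ 1) (c : PBond P (j + 1))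
    (hα : ∀ i, dist1 (loopHol U₀ c i) ≤ α) (hα24 : α ≤ 1 / 24) (hN : 2 * ((((P.d + 2) * P.L : ℕ) : ℝ) * δ) + α < deltaSU n) :
    ‖((avgFun (expMeanLogSU (n := n)) U c : Matrix.specialUnitaryGroup n ℂ) : Matrix n n ℂ) *
          star ((avgFun (expMeanLogSU (n := n)) U₀ c : Matrix.specialUnitaryGroup n ℂ) : Matrix n n ℂ) - 1 -
        covLinAvg U₀ (pertVar U₀ U) c‖ ≤
      400 * ((((P.d + 2) * P.L : ℕ) : ℝ) * δ) * ((((P.d + 2) * P.L : ℕ) : ℝ) * δ + α) := by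
  -- letters
  set ℓ : ℝ := (((P.d + 2) * P.L : ℕ) : ℝ) with hℓ
  set t : ℝ := ℓ * δ with ht
  have hℓ0 : 0 ≤ ℓ := Nat.cast_nonneg _
  have ht0 : 0 ≤ t := mul_nonneg hℓ0 hδ
  have ht48 : t ≤ 1 / 48 := by linarith
  have hℓδ : ℓ * δ ≤ 1 / 2 := by rw [← ht]; linarith
  have hα0 : 0 ≤ α := (GaugeGroup.dist1_nonneg _).trans (hα (Classical.arbitrary _))
  set Y : PBond P j → Matrix n n ℂ := pertVar U₀ U with hYdef
  -- the loop variables of `U` and of `U₀`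
  set W : Idx P → Matrix n n ℂ := fun i => ((loopHol U c i : Matrix.specialUnitaryGroup n ℂ) : Matrix n n ℂ) with hW
  set W₀ : Idx P → Matrix n n ℂ := fun i => ((loopHol U₀ c i : Matrix.specialUnitaryGroup n ℂ) : Matrix n n ℂ) with hW₀
  set Λ : Idx P → Matrix n n ℂ := fun i => covWalkSum U₀ Y (walk (emb c.src) (loopWord P.L c.dir (off i.1) i.2.1 i.2.2)) with hΛ
  have hlen : ∀ i : Idx P, (walk (emb c.src) (loopWord P.L c.dir (off i.1) i.2.1 i.2.2)).length ≤ (P.d + 2) * P.L :=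
    fun i => ((length_walk _ _).le.trans (length_loopWord_le c i))
  have hratio : ∀ i, ‖W i * star (W₀ i) - 1‖ ≤ 2 * t ∧ ‖W i * star (W₀ i) - 1 - Λ i‖ ≤ 3 * t ^ 2 := by
    intro i
    have h := norm_holRatio_bounds_of_length_le U₀ U hδ hY hℓδ _ (hlen i)
    have e1 : 2 * (((P.d + 2) * P.L : ℕ) : ℝ) * δ = 2 * t := by rw [ht, hℓ]; ring
    have e2 : 3 * (((P.d + 2) * P.L : ℕ) : ℝ) ^ 2 * δ ^ 2 = 3 * t ^ 2 := by rw [ht, hℓ]; ring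
    rw [e1, e2] at h
    exact h
  have hΛn : ∀ i, ‖Λ i‖ ≤ t := fun i => by
    have h1 := norm_covWalkSum_le U₀ hY (walk (emb c.src) (loopWord P.L c.dir (off i.1) i.2.1 i.2.2))
    have h2 : ((walk (emb c.src) (loopWord P.L c.dir (off i.1) i.2.1 i.2.2)).length : ℝ) ≤ ℓ := by
      rw [hℓ]; exact_mod_cast hlen i
    rw [ht]; exact h1.trans (mul_le_mul_of_nonneg_right h2 hδ)
  -- unitarity of the background loop variables and their size
  have hW₀u : ∀ i, star (W₀ i) * W₀ i = 1 := fun i => coe_star_mul_self _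
  have hW₀1 : ∀ i, ‖W₀ i - 1‖ ≤ α := fun i => by rw [hW₀, ← FederbushMean.dist1_SU_eq]; exact hα i
  have hW₀n : ∀ i, ‖W₀ i‖ = 1 := fun i => norm_coe_eq_one _
  -- the increments `V = W − W₀`
  set V : Idx P → Matrix n n ℂ := W - W₀ with hV
  have hVi : ∀ i, V i = (W i * star (W₀ i) - 1) * W₀ i := fun i => by
    simp only [hV, Pi.sub_apply]; rw [sub_mul, mul_assoc, hW₀u, mul_one, one_mul]
  have hVn : ∀ i, ‖V i‖ ≤ 2 * t := fun i => by
    rw [hVi]; exact (norm_mul_le _ _).trans (by rw [hW₀n, mul_one]; exact (hratio i).1)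
  have hVΛ : ∀ i, ‖V i - Λ i‖ ≤ 3 * t ^ 2 + t * α := by
    intro i
    have e : V i - Λ i = (W i * star (W₀ i) - 1 - Λ i) * W₀ i + Λ i * (W₀ i - 1) := by rw [hVi]; noncomm_ring
    rw [e]
    calc _ ≤ ‖W i * star (W₀ i) - 1 - Λ i‖ * ‖W₀ i‖ + ‖Λ i‖ * ‖W₀ i - 1‖ :=
          (norm_add_le _ _).trans (add_le_add (norm_mul_le _ _) (norm_mul_le _ _))
      _ ≤ 3 * t ^ 2 * 1 + t * α := by
          gcongr
          · exact (hratio i).2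
          · exact (hW₀n i).le
          · exact hΛn i
          · exact hW₀1 i
      _ = 3 * t ^ 2 + t * α := by ring
  -- the guards: both families are small
  have hsmall₀ : ∀ i, dist1 (loopHol U₀ c i) < deltaSU n := fun i => (hα i).trans_lt (by linarith)
  have hsmall : ∀ i, dist1 (loopHol U c i) < deltaSU n := by
    intro i
    rw [FederbushMean.dist1_SU_eq]
    have e : ((loopHol U c i : Matrix.specialUnitaryGroup n ℂ) : Matrix n n ℂ) - 1 = V i + (W₀ i - 1) := by
      simp only [hV, Pi.sub_apply, hW]; abel
    rw [e]
    calc ‖V i + (W₀ i - 1)‖ ≤ 2 * t + α := (norm_add_le _ _).trans (add_le_add (hVn i) (hW₀1 i))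
      _ < deltaSU n := by rw [ht]; exact hN
  -- the correction factors as `eml`
  set κ : Matrix n n ℂ := ((corr (expMeanLogSU (n := n)) U c : Matrix.specialUnitaryGroup n ℂ) : Matrix n n ℂ) with hκ
  set κ₀ : Matrix n n ℂ := ((corr (expMeanLogSU (n := n)) U₀ c : Matrix.specialUnitaryGroup n ℂ) : Matrix n n ℂ) with hκ₀
  have hsmallS : Small (expMeanLogSU (n := n)) U c := hsmall
  have hsmallS₀ : Small (expMeanLogSU (n := n)) U₀ c := hsmall₀
  have hκeml : κ = eml (W₀ + V) := by
    have h1 : κ = eml W := by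
      rw [hκ]; unfold corr; rw [if_pos hsmallS, BlockAveragingEMLProp2.coe_avg_eq_eml _ hsmall]
    rw [h1, hV, add_sub_cancel]
  have hκ₀eml : κ₀ = eml W₀ := by
    rw [hκ₀]; unfold corr; rw [if_pos hsmallS₀, BlockAveragingEMLProp2.coe_avg_eq_eml _ hsmall₀]
  -- sup norms of the families
  have hW₀sup : ‖W₀ - 1‖ ≤ 1 / 24 := (pi_norm_le_iff_of_nonneg (by norm_num)).2 fun i => (hW₀1 i).trans hα24
  have hW₀sup' : ‖W₀ - 1‖ ≤ α := (pi_norm_le_iff_of_nonneg hα0).2 fun i => hW₀1 i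
  have hVsup : ‖V‖ ≤ 2 * t := (pi_norm_le_iff_of_nonneg (by positivity)).2 fun i => hVn i
  have hVsup' : ‖V‖ ≤ 1 / 24 := hVsup.trans (by linarith)
  -- `κ − κ₀` to first order
  have hE₁ : ‖κ - κ₀ - ((Fintype.card (Idx P) : ℂ))⁻¹ • ∑ i, V i‖ ≤ 48 * (2 * t) ^ 2 + 144 * (2 * t) * α := by
    rw [hκeml, hκ₀eml]
    refine (norm_eml_add_sub_sub_mean_le hW₀sup hVsup').trans ?_
    have hVn0 : 0 ≤ ‖V‖ := norm_nonneg _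
    nlinarith [mul_le_mul hVsup hVsup hVn0 (by positivity), mul_le_mul hVsup hW₀sup' (norm_nonneg _) (by positivity)]
  have hE₂ : ‖((Fintype.card (Idx P) : ℂ))⁻¹ • ∑ i, V i - ((Fintype.card (Idx P) : ℂ))⁻¹ • ∑ i, Λ i‖ ≤ 3 * t ^ 2 + t * α := by
    rw [← smul_sub, ← Finset.sum_sub_distrib]
    exact norm_mean_le hVΛ
  set H : Matrix n n ℂ := κ - κ₀ with hH
  set mΛ : Matrix n n ℂ := ((Fintype.card (Idx P) : ℂ))⁻¹ • ∑ i, Λ i with hmΛ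
  have hHm : ‖H - mΛ‖ ≤ 195 * t ^ 2 + 289 * t * α := by
    have e : H - mΛ = (κ - κ₀ - ((Fintype.card (Idx P) : ℂ))⁻¹ • ∑ i, V i) +
        (((Fintype.card (Idx P) : ℂ))⁻¹ • ∑ i, V i - mΛ) := by rw [hH]; abel
    rw [e]
    refine (norm_add_le _ _).trans ((add_le_add hE₁ hE₂).trans ?_)
    nlinarith
  have hmΛn : ‖mΛ‖ ≤ t := norm_mean_le hΛn
  -- the background correction factor is near `1` and unitary
  have hκ₀1 : ‖κ₀ - 1‖ ≤ 2 * α := by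
    rw [hκ₀, ← FederbushMean.dist1_SU_eq]
    exact BlockAveragingEMLProp2.dist1_corr_le_two_mul U₀ c hα (by linarith) (hα24.trans (by norm_num))
  have hκ₀u : κ₀ * star κ₀ = 1 := coe_mul_star_self _
  have hκ₀s1 : ‖star κ₀ - 1‖ ≤ 2 * α := by
    rw [← star_one, ← star_sub, norm_star]; exact hκ₀1
  have hκ₀sn : ‖star κ₀‖ = 1 := by rw [hκ₀, ← coe_inv_eq_star]; exact norm_coe_eq_one _
  have hκ1 : ‖κ - 1‖ ≤ 2 * α + t + (195 * t ^ 2 + 289 * t * α) := by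
    have e : κ - 1 = (κ₀ - 1) + mΛ + (H - mΛ) := by rw [hH]; abel
    rw [e]
    exact (norm_add_le _ _).trans (add_le_add ((norm_add_le _ _).trans (add_le_add hκ₀1 hmΛn)) hHm)
  -- the straight factors
  set S : Matrix n n ℂ := ((axialAvg U c : Matrix.specialUnitaryGroup n ℂ) : Matrix n n ℂ) with hS
  set S₀ : Matrix n n ℂ := ((axialAvg U₀ c : Matrix.specialUnitaryGroup n ℂ) : Matrix n n ℂ) with hS₀
  set ΛS : Matrix n n ℂ := covWalkSum U₀ Y (walk (emb c.src) (List.replicate P.L (c.dir, true))) with hΛS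
  set G : Matrix n n ℂ := S * star S₀ - 1 with hG
  have hSlen : (walk (emb c.src) (List.replicate P.L (c.dir, true))).length ≤ (P.d + 2) * P.L := length_walk_replicate_le _ _ _
  have hGb : ‖G‖ ≤ 2 * t ∧ ‖G - ΛS‖ ≤ 3 * t ^ 2 := by
    have h := norm_holRatio_bounds_of_length_le U₀ U hδ hY hℓδ _ hSlen
    have e1 : 2 * (((P.d + 2) * P.L : ℕ) : ℝ) * δ = 2 * t := by rw [ht, hℓ]; ring
    have e2 : 3 * (((P.d + 2) * P.L : ℕ) : ℝ) ^ 2 * δ ^ 2 = 3 * t ^ 2 := by rw [ht, hℓ]; ring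
    rw [e1, e2] at h
    rw [hG, hS, hS₀, hΛS, axialAvg_eq_holAt_walk, axialAvg_eq_holAt_walk]
    exact h
  -- the averaged configurations
  have hU' : ((avgFun (expMeanLogSU (n := n)) U c : Matrix.specialUnitaryGroup n ℂ) : Matrix n n ℂ) = κ * S := by
    rw [hκ, hS, ← Submonoid.coe_mul]; rfl
  have hU₀' : ((avgFun (expMeanLogSU (n := n)) U₀ c : Matrix.specialUnitaryGroup n ℂ) : Matrix n n ℂ) = κ₀ * S₀ := by
    rw [hκ₀, hS₀, ← Submonoid.coe_mul]; rfl
  have hlin : covLinAvg U₀ Y c = mΛ + ΛS := rfl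
  -- the algebra: `κ S (κ₀ S₀)* − 1 − (mΛ + ΛS) = (H − mΛ) + H(κ₀* − 1) + (G − ΛS) + (κ − 1)Gκ₀* + G(κ₀* − 1)`
  have e : κ * S * star (κ₀ * S₀) - 1 - (mΛ + ΛS) =
      (H - mΛ) + H * (star κ₀ - 1) + (G - ΛS) + (κ - 1) * G * star κ₀ + G * (star κ₀ - 1) := by
    rw [star_mul, hH, hG]
    have e1 : κ * S * (star S₀ * star κ₀) = κ * (S * star S₀ - 1) * star κ₀ + (κ - κ₀) * star κ₀ + κ₀ * star κ₀ := by noncomm_ring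
    rw [e1, hκ₀u]
    noncomm_ring
  rw [hU', hU₀', hlin, e]
  have hHn : ‖H‖ ≤ t + (195 * t ^ 2 + 289 * t * α) := by
    have e2 : H = mΛ + (H - mΛ) := by abel
    rw [e2]; exact (norm_add_le _ _).trans (add_le_add hmΛn hHm)
  calc ‖(H - mΛ) + H * (star κ₀ - 1) + (G - ΛS) + (κ - 1) * G * star κ₀ + G * (star κ₀ - 1)‖
      ≤ ‖H - mΛ‖ + ‖H‖ * ‖star κ₀ - 1‖ + ‖G - ΛS‖ + ‖κ - 1‖ * ‖G‖ * ‖star κ₀‖ + ‖G‖ * ‖star κ₀ - 1‖ := by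
        refine (norm_add_le _ _).trans (add_le_add ?_ (norm_mul_le _ _))
        refine (norm_add_le _ _).trans (add_le_add ?_ ((norm_mul_le _ _).trans (mul_le_mul_of_nonneg_right (norm_mul_le _ _) (norm_nonneg _))))
        refine (norm_add_le _ _).trans (add_le_add ?_ le_rfl)
        exact (norm_add_le _ _).trans (add_le_add le_rfl (norm_mul_le _ _))
    _ ≤ (195 * t ^ 2 + 289 * t * α) + (t + (195 * t ^ 2 + 289 * t * α)) * (2 * α) + 3 * t ^ 2 +
          (2 * α + t + (195 * t ^ 2 + 289 * t * α)) * (2 * t) * 1 + 2 * t * (2 * α) := by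
        have hE0 : 0 ≤ t + (195 * t ^ 2 + 289 * t * α) := by positivity
        have hK0 : 0 ≤ 2 * α + t + (195 * t ^ 2 + 289 * t * α) := by positivity
        refine add_le_add (add_le_add (add_le_add (add_le_add hHm ?_) hGb.2) ?_) ?_
        · exact mul_le_mul hHn hκ₀s1 (norm_nonneg _) hE0
        · exact mul_le_mul (mul_le_mul hκ1 hGb.1 (norm_nonneg _) hK0) hκ₀sn.le (norm_nonneg _) (by positivity)
        · exact mul_le_mul hGb.1 hκ₀s1 (norm_nonneg _) (by positivity)
    _ ≤ 400 * t * (t + α) := by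
        have m1 : t ^ 2 * α ≤ t ^ 2 * (1 / 24) := mul_le_mul_of_nonneg_left hα24 (sq_nonneg t)
        have m2 : t * α * α ≤ t * α * (1 / 24) := mul_le_mul_of_nonneg_left hα24 (mul_nonneg ht0 hα0)
        have m3 : t ^ 2 * t ≤ t ^ 2 * (1 / 48) := mul_le_mul_of_nonneg_left ht48 (sq_nonneg t)
        have m4 : t * α * t ≤ t * α * (1 / 48) := mul_le_mul_of_nonneg_left ht48 (mul_nonneg ht0 hα0)
        nlinarith [mul_nonneg ht0 hα0, sq_nonneg t, m1, m2, m3, m4]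

end Main

/-! ## §5 (v1.1) The `R₀` form of the linear term: comb sum, comb-transported straight line, loop-transported comb sum -/

section R0

open T4Continuum BlockAveraging AveragingRT LatticeWordStokes ExpMeanLog
open scoped Matrix.Norms.L2Operator

variable {n : Type*} [Fintype n] [DecidableEq n] [Nonempty n] {P : Params} {j : ℕ}

/-- `(x + e_μ) − e_μ = x` on the torus. [cite: Balaban1987RG1, (0.1) p.252 (bookkeeping)] -/
private theorem unshift_shift' (x : Site P j) (μ : Fin P.d) : (x.shift μ).unshift μ = x := by
  funext ν
  by_cases h : ν = μ
  · subst h; simp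
  · simp [Site.shift_apply, Site.unshift_apply, h]

/-- **REVERSED WALKS**: the covariant signed sum along `−Γ` (from the end of `Γ`) is minus the one along `Γ`, transported to the new start by the
background holonomy: `Y_{U₀}(−Γ) = −U₀(Γ)⁻¹·Y_{U₀}(Γ)·U₀(Γ)` (the linear shadow of `U(−Γ) = U(Γ)⁻¹`). [cite: Balaban1985Averaging, (58) p.27] -/
theorem covWalkSum_walk_wordRev (U₀ : GaugeField P j (Matrix.specialUnitaryGroup n ℂ)) (Y : PBond P j → Matrix n n ℂ) :
    ∀ (x : Site P j) (w : List (Letter P.d)),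
      covWalkSum U₀ Y (walk (walkEnd x w) (wordRev w)) =
        -(star ((holAt U₀ (walk x w) : Matrix.specialUnitaryGroup n ℂ) : Matrix n n ℂ) * covWalkSum U₀ Y (walk x w) *
          ((holAt U₀ (walk x w) : Matrix.specialUnitaryGroup n ℂ) : Matrix n n ℂ))
  | x, [] => by simp [walk, walkEnd, holAt_nil, wordRev]
  | x, (μ, true) :: w => by
    have h1 : wordRev ((μ, true) :: w) = wordRev w ++ [(μ, false)] := by rw [wordRev_cons]; rfl
    rw [h1]
    simp only [walkEnd, walk]
    rw [walk_append, covWalkSum_append, covWalkSum_walk_wordRev U₀ Y (x.shift μ) w, walkEnd_walkEnd_wordRev, holAt_walk_wordRev,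
      coe_inv_eq_star, star_star, covWalkSum_cons, holAt_cons]
    simp only [walk, covWalkSum_cons, covWalkSum_nil, covStep, stepFactor, unshift_shift', Bool.false_eq_true, ↓reduceIte, mul_zero,
      zero_mul, add_zero, Submonoid.coe_mul, star_mul, star_star]
    have hu := coe_star_mul_self (U₀ ⟨x, μ⟩)
    set u : Matrix n n ℂ := ((U₀ ⟨x, μ⟩ : Matrix.specialUnitaryGroup n ℂ) : Matrix n n ℂ)
    set T : Matrix n n ℂ := ((holAt U₀ (walk (x.shift μ) w) : Matrix.specialUnitaryGroup n ℂ) : Matrix n n ℂ)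
    set Λ : Matrix n n ℂ := covWalkSum U₀ Y (walk (x.shift μ) w)
    -- `−T*ΛT + T*(−(u* Y u))T = −(T* u*)(Y + u Λ u*)(u T)`
    have e : star T * star u * (Y ⟨x, μ⟩ + u * Λ * star u) * (u * T) =
        star T * (star u * Y ⟨x, μ⟩ * u) * T + star T * (star u * u) * Λ * (star u * u) * T := by noncomm_ring
    rw [e, hu]
    noncomm_ring
  | x, (μ, false) :: w => by
    have h1 : wordRev ((μ, false) :: w) = wordRev w ++ [(μ, true)] := by rw [wordRev_cons]; rfl
    rw [h1]
    simp only [walkEnd, walk]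
    rw [walk_append, covWalkSum_append, covWalkSum_walk_wordRev U₀ Y (x.unshift μ) w, walkEnd_walkEnd_wordRev, holAt_walk_wordRev,
      coe_inv_eq_star, star_star, covWalkSum_cons, holAt_cons]
    simp only [walk, covWalkSum_cons, covWalkSum_nil, covStep, stepFactor, Bool.false_eq_true, ↓reduceIte, mul_zero,
      zero_mul, add_zero, Submonoid.coe_mul, star_mul, star_star, coe_inv_eq_star]
    have hu := coe_mul_star_self (U₀ ⟨x.unshift μ, μ⟩)
    set u : Matrix n n ℂ := ((U₀ ⟨x.unshift μ, μ⟩ : Matrix.specialUnitaryGroup n ℂ) : Matrix n n ℂ)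
    set T : Matrix n n ℂ := ((holAt U₀ (walk (x.unshift μ) w) : Matrix.specialUnitaryGroup n ℂ) : Matrix n n ℂ)
    set Λ : Matrix n n ℂ := covWalkSum U₀ Y (walk (x.unshift μ) w)
    have e : star T * u * (-(star u * Y ⟨x.unshift μ, μ⟩ * u) + star u * Λ * u) * (star u * T) =
        -(star T * (u * star u) * Y ⟨x.unshift μ, μ⟩ * (u * star u) * T) + star T * (u * star u) * Λ * (u * star u) * T := by
      noncomm_ring
    rw [e, hu]
    noncomm_ring

/-- **THE `R₀` FORM OF THE LINEARISED (0.4) AVERAGE AT `U₀`**: for the index `i = (n, σ, σ′)` let `A₀, B₀, C₀` be the background holonomies of the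
three segments `Γ^σ_{y→x}`, `[x,x′]`, `Γ^{σ′}_{y′→x′}` and `T = A₀B₀C₀⁻¹`; then
`(Q₁^{R₀}(U₀)Y)(c) = |I|⁻¹ Σ_i [ Y_{U₀}(Γ^σ_{y→x}) + R(A₀)·Y_{U₀}([x,x′]) − R(T)·Y_{U₀}(Γ^{σ′}_{y′→x′}) ]` — the covariant comb sum at `y`, the
covariant straight-line sum of the COMB-TRANSPORTED perturbation (print's main term (125) on `R_{0,c₋}A`; the route's `A^{U₀}` up to the comb
convention), and the loop-transported covariant comb sum at `y′` (the two comb terms are the linearised coarse gauge transformation of [B7] (62)–(63)).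
[cite: Balaban1985Averaging, (124)-(125) p.36] -/
def covLinAvgR0 (U₀ : GaugeField P j (Matrix.specialUnitaryGroup n ℂ)) (Y : PBond P j → Matrix n n ℂ) (c : PBond P (j + 1)) : Matrix n n ℂ :=
  ((Fintype.card (Idx P) : ℂ))⁻¹ • ∑ i : Idx P,
    (covWalkSum U₀ Y (walk (emb c.src) (stairWord i.2.1 (off i.1))) +
      ((holAt U₀ (walk (emb c.src) (stairWord i.2.1 (off i.1))) : Matrix.specialUnitaryGroup n ℂ) : Matrix n n ℂ) *
          covWalkSum U₀ Y (walk (walkEnd (emb c.src) (stairWord i.2.1 (off i.1))) (List.replicate P.L (c.dir, true))) *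
        star ((holAt U₀ (walk (emb c.src) (stairWord i.2.1 (off i.1))) : Matrix.specialUnitaryGroup n ℂ) : Matrix n n ℂ) -
      ((holAt U₀ (walk (emb c.src) (stairWord i.2.1 (off i.1))) *
            holAt U₀ (walk (walkEnd (emb c.src) (stairWord i.2.1 (off i.1))) (List.replicate P.L (c.dir, true))) *
            (holAt U₀ (walk (emb c.tgt) (stairWord i.2.2 (off i.1))))⁻¹ : Matrix.specialUnitaryGroup n ℂ) : Matrix n n ℂ) *
          covWalkSum U₀ Y (walk (emb c.tgt) (stairWord i.2.2 (off i.1))) *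
        star ((holAt U₀ (walk (emb c.src) (stairWord i.2.1 (off i.1))) *
            holAt U₀ (walk (walkEnd (emb c.src) (stairWord i.2.1 (off i.1))) (List.replicate P.L (c.dir, true))) *
            (holAt U₀ (walk (emb c.tgt) (stairWord i.2.2 (off i.1))))⁻¹ : Matrix.specialUnitaryGroup n ℂ) : Matrix n n ℂ))

/-- **PER INDEX, THE LOOP TERM IN `R₀` FORM**: `Y_{U₀}(loop_i) + Y_{U₀}([y,y′]) = [comb + R(A₀)line − R(T)comb′] + (Y_{U₀}([y,y′]) − R(W⁰_i)Y_{U₀}([y,y′]))`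
with `W⁰_i` the background loop variable (the `(−c)` segment is `[y,y′]` reversed, transported by `T`; `T·U₀(c)⁻¹ = W⁰_i`). [cite: Balaban1985Averaging, (124) p.36] -/
theorem covWalkSum_loop_eq (U₀ : GaugeField P j (Matrix.specialUnitaryGroup n ℂ)) (Y : PBond P j → Matrix n n ℂ) (c : PBond P (j + 1)) (i : Idx P) :
    covWalkSum U₀ Y (walk (emb c.src) (loopWord P.L c.dir (off i.1) i.2.1 i.2.2)) +
        covWalkSum U₀ Y (walk (emb c.src) (List.replicate P.L (c.dir, true))) =
      (covWalkSum U₀ Y (walk (emb c.src) (stairWord i.2.1 (off i.1))) +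
        ((holAt U₀ (walk (emb c.src) (stairWord i.2.1 (off i.1))) : Matrix.specialUnitaryGroup n ℂ) : Matrix n n ℂ) *
            covWalkSum U₀ Y (walk (walkEnd (emb c.src) (stairWord i.2.1 (off i.1))) (List.replicate P.L (c.dir, true))) *
          star ((holAt U₀ (walk (emb c.src) (stairWord i.2.1 (off i.1))) : Matrix.specialUnitaryGroup n ℂ) : Matrix n n ℂ) -
        ((holAt U₀ (walk (emb c.src) (stairWord i.2.1 (off i.1))) *
              holAt U₀ (walk (walkEnd (emb c.src) (stairWord i.2.1 (off i.1))) (List.replicate P.L (c.dir, true))) *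
              (holAt U₀ (walk (emb c.tgt) (stairWord i.2.2 (off i.1))))⁻¹ : Matrix.specialUnitaryGroup n ℂ) : Matrix n n ℂ) *
            covWalkSum U₀ Y (walk (emb c.tgt) (stairWord i.2.2 (off i.1))) *
          star ((holAt U₀ (walk (emb c.src) (stairWord i.2.1 (off i.1))) *
              holAt U₀ (walk (walkEnd (emb c.src) (stairWord i.2.1 (off i.1))) (List.replicate P.L (c.dir, true))) *
              (holAt U₀ (walk (emb c.tgt) (stairWord i.2.2 (off i.1))))⁻¹ : Matrix.specialUnitaryGroup n ℂ) : Matrix n n ℂ)) +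
      (covWalkSum U₀ Y (walk (emb c.src) (List.replicate P.L (c.dir, true))) -
        ((loopHol U₀ c i : Matrix.specialUnitaryGroup n ℂ) : Matrix n n ℂ) * covWalkSum U₀ Y (walk (emb c.src) (List.replicate P.L (c.dir, true))) *
          star ((loopHol U₀ c i : Matrix.specialUnitaryGroup n ℂ) : Matrix n n ℂ)) := by
  -- split the loop word into its four segments
  have hsplit : covWalkSum U₀ Y (walk (emb c.src) (loopWord P.L c.dir (off i.1) i.2.1 i.2.2)) =
      covWalkSum U₀ Y (walk (emb c.src) (stairWord i.2.1 (off i.1))) +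
        ((holAt U₀ (walk (emb c.src) (stairWord i.2.1 (off i.1))) : Matrix.specialUnitaryGroup n ℂ) : Matrix n n ℂ) *
          (covWalkSum U₀ Y (walk (walkEnd (emb c.src) (stairWord i.2.1 (off i.1))) (List.replicate P.L (c.dir, true))) +
            ((holAt U₀ (walk (walkEnd (emb c.src) (stairWord i.2.1 (off i.1))) (List.replicate P.L (c.dir, true))) :
                Matrix.specialUnitaryGroup n ℂ) : Matrix n n ℂ) *
              (-(star ((holAt U₀ (walk (emb c.tgt) (stairWord i.2.2 (off i.1))) : Matrix.specialUnitaryGroup n ℂ) : Matrix n n ℂ) *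
                    covWalkSum U₀ Y (walk (emb c.tgt) (stairWord i.2.2 (off i.1))) *
                    ((holAt U₀ (walk (emb c.tgt) (stairWord i.2.2 (off i.1))) : Matrix.specialUnitaryGroup n ℂ) : Matrix n n ℂ)) +
                star ((holAt U₀ (walk (emb c.tgt) (stairWord i.2.2 (off i.1))) : Matrix.specialUnitaryGroup n ℂ) : Matrix n n ℂ) *
                  (-(star ((axialAvg U₀ c : Matrix.specialUnitaryGroup n ℂ) : Matrix n n ℂ) *
                      covWalkSum U₀ Y (walk (emb c.src) (List.replicate P.L (c.dir, true))) *
                      ((axialAvg U₀ c : Matrix.specialUnitaryGroup n ℂ) : Matrix n n ℂ))) *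
                  star (star ((holAt U₀ (walk (emb c.tgt) (stairWord i.2.2 (off i.1))) : Matrix.specialUnitaryGroup n ℂ) : Matrix n n ℂ))) *
              star ((holAt U₀ (walk (walkEnd (emb c.src) (stairWord i.2.1 (off i.1))) (List.replicate P.L (c.dir, true))) :
                Matrix.specialUnitaryGroup n ℂ) : Matrix n n ℂ)) *
          star ((holAt U₀ (walk (emb c.src) (stairWord i.2.1 (off i.1))) : Matrix.specialUnitaryGroup n ℂ) : Matrix n n ℂ) := by
    unfold loopWord
    rw [walk_append, covWalkSum_append, walk_append, covWalkSum_append, walk_append, covWalkSum_append,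
      BlockAveragingEMLProp2.walkEnd_stairWord_replicate c.src c.dir i.2.1 i.2.2 (off i.1)]
    rw [show c.src.shift c.dir = c.tgt from rfl, covWalkSum_walk_wordRev, holAt_walk_wordRev, walkEnd_walkEnd_wordRev, coe_inv_eq_star]
    have h4 : List.replicate P.L (c.dir, false) = wordRev (List.replicate P.L (c.dir, true)) := by rw [wordRev_replicate]; rfl
    rw [h4, show emb c.tgt = walkEnd (emb c.src) (List.replicate P.L (c.dir, true)) from (walkEnd_replicate_L c.src c.dir).symm,
      covWalkSum_walk_wordRev, ← axialAvg_eq_holAt_walk, walkEnd_replicate_L]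
  -- the background loop variable factorised
  have hW := BlockAveragingEMLProp2.loopHol_eq U₀ c i
  rw [hsplit, hW]
  simp only [Submonoid.coe_mul, coe_inv_eq_star, star_mul, star_star]
  noncomm_ring

/-- The `R₀` form differs from `covLinAvg` by the mean of the conjugation defects `Y_{U₀}([y,y′]) − R(W⁰_i)Y_{U₀}([y,y′])`. [cite: Balaban1985Averaging, (124) p.36] -/
theorem covLinAvg_sub_covLinAvgR0 (U₀ : GaugeField P j (Matrix.specialUnitaryGroup n ℂ)) (Y : PBond P j → Matrix n n ℂ) (c : PBond P (j + 1)) :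
    covLinAvg U₀ Y c - covLinAvgR0 U₀ Y c = ((Fintype.card (Idx P) : ℂ))⁻¹ • ∑ i : Idx P,
      (covWalkSum U₀ Y (walk (emb c.src) (List.replicate P.L (c.dir, true))) -
        ((loopHol U₀ c i : Matrix.specialUnitaryGroup n ℂ) : Matrix n n ℂ) * covWalkSum U₀ Y (walk (emb c.src) (List.replicate P.L (c.dir, true))) *
          star ((loopHol U₀ c i : Matrix.specialUnitaryGroup n ℂ) : Matrix n n ℂ)) := by
  have hc : (Fintype.card (Idx P) : ℂ) ≠ 0 := Nat.cast_ne_zero.mpr Fintype.card_pos.ne'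
  -- `covLinAvg = mean_i (Λ_i + Λ_S)` (the straight term is a constant family)
  have hmean : covLinAvg U₀ Y c = ((Fintype.card (Idx P) : ℂ))⁻¹ • ∑ i : Idx P,
      (covWalkSum U₀ Y (walk (emb c.src) (loopWord P.L c.dir (off i.1) i.2.1 i.2.2)) +
        covWalkSum U₀ Y (walk (emb c.src) (List.replicate P.L (c.dir, true)))) := by
    rw [covLinAvg_def, Finset.sum_add_distrib, smul_add, Finset.sum_const, Finset.card_univ, ← Nat.cast_smul_eq_nsmul ℂ, smul_smul,
      inv_mul_cancel₀ hc, one_smul]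
  rw [hmean, covLinAvgR0, ← smul_sub, ← Finset.sum_sub_distrib]
  congr 1
  refine Finset.sum_congr rfl fun i _ => ?_
  rw [covWalkSum_loop_eq]
  abel

/-- **THE ESTIMATE IN `R₀` FORM**: under the hypotheses of `norm_avgFun_ratio_sub_one_sub_covLinAvg_le`,
`‖Ū(c)·Ū₀(c)* − 1 − (Q₁^{R₀}(U₀)Y)(c)‖ ≤ 404·ℓδ·(ℓδ + α)` — the conjugation defects are `≤ 2α·ℓδ` each since the background loop variables are
within `α` of `1`.  This is the form the route's coercivity files consume: the middle term of `covLinAvgR0` is the covariant straight-line block average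
of the comb-transported perturbation (the slice `A^{U₀}Y = 0`), the two comb terms are the linearised coarse gauge transformation (62) to be fixed by
the chart's condition (20)∕(1.37). [cite: Balaban1985Averaging, Prop. 3 (122)-(125) p.36] -/
theorem norm_avgFun_ratio_sub_one_sub_covLinAvgR0_le (U₀ U : GaugeField P j (Matrix.specialUnitaryGroup n ℂ)) {δ α : ℝ} (hδ : 0 ≤ δ)
    (hY : ∀ b, ‖pertVar U₀ U b‖ ≤ δ) (h48 : 48 * ((((P.d + 2) * P.L : ℕ) : ℝ) * δ) ≤ 1) (c : PBond P (j + 1))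
    (hα : ∀ i, dist1 (loopHol U₀ c i) ≤ α) (hα24 : α ≤ 1 / 24) (hN : 2 * ((((P.d + 2) * P.L : ℕ) : ℝ) * δ) + α < deltaSU n) :
    ‖((avgFun (expMeanLogSU (n := n)) U c : Matrix.specialUnitaryGroup n ℂ) : Matrix n n ℂ) *
          star ((avgFun (expMeanLogSU (n := n)) U₀ c : Matrix.specialUnitaryGroup n ℂ) : Matrix n n ℂ) - 1 -
        covLinAvgR0 U₀ (pertVar U₀ U) c‖ ≤
      404 * ((((P.d + 2) * P.L : ℕ) : ℝ) * δ) * ((((P.d + 2) * P.L : ℕ) : ℝ) * δ + α) := by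
  have ht0 : 0 ≤ (((P.d + 2) * P.L : ℕ) : ℝ) * δ := mul_nonneg (Nat.cast_nonneg _) hδ
  have hα0 : 0 ≤ α := (GaugeGroup.dist1_nonneg _).trans (hα (Classical.arbitrary _))
  have hmain := norm_avgFun_ratio_sub_one_sub_covLinAvg_le U₀ U hδ hY h48 c hα hα24 hN
  have hdiff : ‖covLinAvg U₀ (pertVar U₀ U) c - covLinAvgR0 U₀ (pertVar U₀ U) c‖ ≤ 2 * α * ((((P.d + 2) * P.L : ℕ) : ℝ) * δ) := by
    rw [covLinAvg_sub_covLinAvgR0]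
    refine norm_mean_le fun i => ?_
    exact conj_defect_le U₀ U hδ hY c i (hα i)
  have e : ((avgFun (expMeanLogSU (n := n)) U c : Matrix.specialUnitaryGroup n ℂ) : Matrix n n ℂ) *
        star ((avgFun (expMeanLogSU (n := n)) U₀ c : Matrix.specialUnitaryGroup n ℂ) : Matrix n n ℂ) - 1 - covLinAvgR0 U₀ (pertVar U₀ U) c =
      (((avgFun (expMeanLogSU (n := n)) U c : Matrix.specialUnitaryGroup n ℂ) : Matrix n n ℂ) *
          star ((avgFun (expMeanLogSU (n := n)) U₀ c : Matrix.specialUnitaryGroup n ℂ) : Matrix n n ℂ) - 1 - covLinAvg U₀ (pertVar U₀ U) c) +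
        (covLinAvg U₀ (pertVar U₀ U) c - covLinAvgR0 U₀ (pertVar U₀ U) c) := by abel
  rw [e]
  refine (norm_add_le _ _).trans ((add_le_add hmain hdiff).trans ?_)
  nlinarith [mul_nonneg ht0 hα0]
  where
  /-- The conjugation defect of the straight term by one background loop variable: `‖Λ_S − W⁰Λ_SW⁰*‖ ≤ 2α·ℓδ`. [cite: Balaban1985Averaging, (124) p.36] -/
  conj_defect_le (U₀ U : GaugeField P j (Matrix.specialUnitaryGroup n ℂ)) {δ : ℝ} (hδ : 0 ≤ δ) (hY : ∀ b, ‖pertVar U₀ U b‖ ≤ δ)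
      (c : PBond P (j + 1)) (i : Idx P) {α : ℝ} (hαi : dist1 (loopHol U₀ c i) ≤ α) :
      ‖covWalkSum U₀ (pertVar U₀ U) (walk (emb c.src) (List.replicate P.L (c.dir, true))) -
          ((loopHol U₀ c i : Matrix.specialUnitaryGroup n ℂ) : Matrix n n ℂ) *
            covWalkSum U₀ (pertVar U₀ U) (walk (emb c.src) (List.replicate P.L (c.dir, true))) *
          star ((loopHol U₀ c i : Matrix.specialUnitaryGroup n ℂ) : Matrix n n ℂ)‖ ≤ 2 * α * ((((P.d + 2) * P.L : ℕ) : ℝ) * δ) := by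
    have hα0 : 0 ≤ α := (GaugeGroup.dist1_nonneg _).trans hαi
    have hΛ : ‖covWalkSum U₀ (pertVar U₀ U) (walk (emb c.src) (List.replicate P.L (c.dir, true)))‖ ≤ (((P.d + 2) * P.L : ℕ) : ℝ) * δ := by
      have h1 := norm_covWalkSum_le U₀ hY (walk (emb c.src) (List.replicate P.L (c.dir, true)))
      have h2 : ((walk (emb c.src) (List.replicate P.L (c.dir, true))).length : ℝ) ≤ (((P.d + 2) * P.L : ℕ) : ℝ) := by
        exact_mod_cast length_walk_replicate_le _ _ _
      exact h1.trans (mul_le_mul_of_nonneg_right h2 hδ)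
    have hW1 : ‖((loopHol U₀ c i : Matrix.specialUnitaryGroup n ℂ) : Matrix n n ℂ) - 1‖ ≤ α := by
      rw [← FederbushMean.dist1_SU_eq]; exact hαi
    have hWs1 : ‖star ((loopHol U₀ c i : Matrix.specialUnitaryGroup n ℂ) : Matrix n n ℂ) - 1‖ ≤ α := by
      rw [← coe_inv_eq_star, ← FederbushMean.dist1_SU_eq, GaugeGroup.dist1_inv]; exact hαi
    have hWsn : ‖star ((loopHol U₀ c i : Matrix.specialUnitaryGroup n ℂ) : Matrix n n ℂ)‖ = 1 := by
      rw [← coe_inv_eq_star]; exact norm_coe_eq_one _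
    have e : ∀ (W X : Matrix n n ℂ), X - W * X * star W = -((W - 1) * X * star W + X * (star W - 1)) := fun W X => by noncomm_ring
    rw [e, norm_neg]
    refine (norm_add_le _ _).trans ?_
    calc ‖(((loopHol U₀ c i : Matrix.specialUnitaryGroup n ℂ) : Matrix n n ℂ) - 1) *
              covWalkSum U₀ (pertVar U₀ U) (walk (emb c.src) (List.replicate P.L (c.dir, true))) *
              star ((loopHol U₀ c i : Matrix.specialUnitaryGroup n ℂ) : Matrix n n ℂ)‖ +
            ‖covWalkSum U₀ (pertVar U₀ U) (walk (emb c.src) (List.replicate P.L (c.dir, true))) *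
              (star ((loopHol U₀ c i : Matrix.specialUnitaryGroup n ℂ) : Matrix n n ℂ) - 1)‖
        ≤ ‖((loopHol U₀ c i : Matrix.specialUnitaryGroup n ℂ) : Matrix n n ℂ) - 1‖ *
              ‖covWalkSum U₀ (pertVar U₀ U) (walk (emb c.src) (List.replicate P.L (c.dir, true)))‖ *
              ‖star ((loopHol U₀ c i : Matrix.specialUnitaryGroup n ℂ) : Matrix n n ℂ)‖ +
            ‖covWalkSum U₀ (pertVar U₀ U) (walk (emb c.src) (List.replicate P.L (c.dir, true)))‖ *
              ‖star ((loopHol U₀ c i : Matrix.specialUnitaryGroup n ℂ) : Matrix n n ℂ) - 1‖ :=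
          add_le_add ((norm_mul_le _ _).trans (mul_le_mul_of_nonneg_right (norm_mul_le _ _) (norm_nonneg _))) (norm_mul_le _ _)
      _ ≤ α * ((((P.d + 2) * P.L : ℕ) : ℝ) * δ) * 1 + ((((P.d + 2) * P.L : ℕ) : ℝ) * δ) * α :=
          add_le_add (mul_le_mul (mul_le_mul hW1 hΛ (norm_nonneg _) hα0) hWsn.le (norm_nonneg _)
            (mul_nonneg hα0 (mul_nonneg (Nat.cast_nonneg _) hδ)))
            (mul_le_mul hΛ hWs1 (norm_nonneg _) (mul_nonneg (Nat.cast_nonneg _) hδ))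
      _ = 2 * α * ((((P.d + 2) * P.L : ℕ) : ℝ) * δ) := by ring

end R0

/-! ## §6 (v1.2) Linearity and size of the linearised operators -/

section Linear

open T4Continuum BlockAveraging AveragingRT LatticeWordStokes
open scoped Matrix.Norms.L2Operator

variable {n : Type*} [Fintype n] [DecidableEq n] [Nonempty n] {P : Params} {j : ℕ}

omit [Nonempty n] in
/-- The covariant signed sum is additive in the bond field. [cite: Balaban1985Averaging, (122) p.36 («a first-order polynomial»)] -/
theorem covWalkSum_add (U₀ : GaugeField P j (Matrix.specialUnitaryGroup n ℂ)) (Y Y' : PBond P j → Matrix n n ℂ) :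
    ∀ γ : List (LStep P j), covWalkSum U₀ (Y + Y') γ = covWalkSum U₀ Y γ + covWalkSum U₀ Y' γ
  | [] => by simp
  | s :: γ => by
    rw [covWalkSum_cons, covWalkSum_cons, covWalkSum_cons, covWalkSum_add U₀ Y Y' γ]
    unfold covStep
    cases s.fwd <;> simp only [Bool.false_eq_true, ↓reduceIte, Pi.add_apply] <;> noncomm_ring

omit [Nonempty n] in
/-- The covariant signed sum is `ℂ`-homogeneous in the bond field. [cite: Balaban1985Averaging, (122) p.36 («a first-order polynomial»)] -/
theorem covWalkSum_smul (U₀ : GaugeField P j (Matrix.specialUnitaryGroup n ℂ)) (a : ℂ) (Y : PBond P j → Matrix n n ℂ) :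
    ∀ γ : List (LStep P j), covWalkSum U₀ (a • Y) γ = a • covWalkSum U₀ Y γ
  | [] => by simp
  | s :: γ => by
    rw [covWalkSum_cons, covWalkSum_cons, covWalkSum_smul U₀ a Y γ]
    unfold covStep
    cases s.fwd <;> simp only [Bool.false_eq_true, ↓reduceIte, Pi.smul_apply, smul_add, smul_neg, Matrix.mul_smul, Matrix.smul_mul]

/-- The `R₀` form of the linearised average is additive in the perturbation. [cite: Balaban1985Averaging, (122) p.36] -/
theorem covLinAvgR0_add (U₀ : GaugeField P j (Matrix.specialUnitaryGroup n ℂ)) (Y Y' : PBond P j → Matrix n n ℂ) (c : PBond P (j + 1)) :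
    covLinAvgR0 U₀ (Y + Y') c = covLinAvgR0 U₀ Y c + covLinAvgR0 U₀ Y' c := by
  simp only [covLinAvgR0, covWalkSum_add, ← smul_add, ← Finset.sum_add_distrib]
  congr 1
  refine Finset.sum_congr rfl fun i _ => ?_
  noncomm_ring

/-- The `R₀` form of the linearised average is `ℂ`-homogeneous in the perturbation. [cite: Balaban1985Averaging, (122) p.36] -/
theorem covLinAvgR0_smul (U₀ : GaugeField P j (Matrix.specialUnitaryGroup n ℂ)) (a : ℂ) (Y : PBond P j → Matrix n n ℂ) (c : PBond P (j + 1)) :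
    covLinAvgR0 U₀ (a • Y) c = a • covLinAvgR0 U₀ Y c := by
  simp only [covLinAvgR0, covWalkSum_smul, Matrix.mul_smul, Matrix.smul_mul, ← smul_add, ← smul_sub, ← Finset.smul_sum]
  rw [smul_comm]

/-- **SIZE OF THE LINEARISED OPERATOR** ([B7] (126) «|Q(V₀)A| ≤ (1 + O(1)L²α₀)α₁», crude form): if `‖Y_b‖ ≤ δ` for every bond then
`‖(Q₁^{R₀}(U₀)Y)(c)‖ ≤ 3ℓδ` (`ℓ = (d+2)L`; each of the three segments has at most `ℓ` steps and the transports are isometries).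
[cite: Balaban1985Averaging, (126) p.36] -/
theorem norm_covLinAvgR0_le (U₀ : GaugeField P j (Matrix.specialUnitaryGroup n ℂ)) {Y : PBond P j → Matrix n n ℂ} {δ : ℝ}
    (hY : ∀ b, ‖Y b‖ ≤ δ) (c : PBond P (j + 1)) :
    ‖covLinAvgR0 U₀ Y c‖ ≤ 3 * ((((P.d + 2) * P.L : ℕ) : ℝ) * δ) := by
  have hδ : 0 ≤ δ := (norm_nonneg _).trans (hY ⟨emb c.src, c.dir⟩)
  have hun : ∀ g : Matrix.specialUnitaryGroup n ℂ, ‖(g : Matrix n n ℂ)‖ = 1 := fun g => norm_coe_eq_one g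
  have hconj : ∀ (g : Matrix.specialUnitaryGroup n ℂ) (X : Matrix n n ℂ), ‖(g : Matrix n n ℂ) * X * star (g : Matrix n n ℂ)‖ ≤ ‖X‖ := by
    intro g X
    calc _ ≤ ‖(g : Matrix n n ℂ)‖ * ‖X‖ * ‖star (g : Matrix n n ℂ)‖ :=
          (norm_mul_le _ _).trans (mul_le_mul_of_nonneg_right (norm_mul_le _ _) (norm_nonneg _))
      _ = ‖X‖ := by rw [norm_star, hun, one_mul, mul_one]
  have hseg : ∀ γ : List (LStep P j), γ.length ≤ (P.d + 2) * P.L → ‖covWalkSum U₀ Y γ‖ ≤ (((P.d + 2) * P.L : ℕ) : ℝ) * δ := by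
    intro γ hγ
    refine (norm_covWalkSum_le U₀ hY γ).trans (mul_le_mul_of_nonneg_right ?_ hδ)
    exact_mod_cast hγ
  unfold covLinAvgR0
  refine norm_mean_le fun i => ?_
  have hA := hseg _ (length_walk_stairWord_le (emb c.src) i.2.1 i.1)
  have hB := hseg _ (length_walk_replicate_le (walkEnd (emb c.src) (stairWord i.2.1 (off i.1))) c.dir true)
  have hC := hseg _ (length_walk_stairWord_le (emb c.tgt) i.2.2 i.1)
  calc _ ≤ ‖covWalkSum U₀ Y (walk (emb c.src) (stairWord i.2.1 (off i.1)))‖ +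
          ‖((holAt U₀ (walk (emb c.src) (stairWord i.2.1 (off i.1))) : Matrix.specialUnitaryGroup n ℂ) : Matrix n n ℂ) *
              covWalkSum U₀ Y (walk (walkEnd (emb c.src) (stairWord i.2.1 (off i.1))) (List.replicate P.L (c.dir, true))) *
            star ((holAt U₀ (walk (emb c.src) (stairWord i.2.1 (off i.1))) : Matrix.specialUnitaryGroup n ℂ) : Matrix n n ℂ)‖ +
          ‖((holAt U₀ (walk (emb c.src) (stairWord i.2.1 (off i.1))) *
                holAt U₀ (walk (walkEnd (emb c.src) (stairWord i.2.1 (off i.1))) (List.replicate P.L (c.dir, true))) *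
                (holAt U₀ (walk (emb c.tgt) (stairWord i.2.2 (off i.1))))⁻¹ : Matrix.specialUnitaryGroup n ℂ) : Matrix n n ℂ) *
              covWalkSum U₀ Y (walk (emb c.tgt) (stairWord i.2.2 (off i.1))) *
            star ((holAt U₀ (walk (emb c.src) (stairWord i.2.1 (off i.1))) *
                holAt U₀ (walk (walkEnd (emb c.src) (stairWord i.2.1 (off i.1))) (List.replicate P.L (c.dir, true))) *
                (holAt U₀ (walk (emb c.tgt) (stairWord i.2.2 (off i.1))))⁻¹ : Matrix.specialUnitaryGroup n ℂ) : Matrix n n ℂ)‖ :=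
        (norm_sub_le _ _).trans (add_le_add (norm_add_le _ _) le_rfl)
    _ ≤ (((P.d + 2) * P.L : ℕ) : ℝ) * δ + (((P.d + 2) * P.L : ℕ) : ℝ) * δ + (((P.d + 2) * P.L : ℕ) : ℝ) * δ :=
        add_le_add (add_le_add hA ((hconj _ _).trans hB)) ((hconj _ _).trans hC)
    _ = 3 * ((((P.d + 2) * P.L : ℕ) : ℝ) * δ) := by ring

end Linear

end Literature.MathematicalPhysics.QuantumFieldTheory.Balaban1983to89.BlockAveragingEMLLinearisedBackground

end
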